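import Mathlib.MeasureTheory.Measure.Hausdorff
import Mathlib.Analysis.SpecificLimits.Basic
import Mathlib.Analysis.SpecialFunctions.Pow.Continuity
import Literature.Barriers.AnomalousDissipation.IntermittentDissipationFinalBound
import HarnessLib

/-!
# De Rosa–Drivas–Inversi–Isett 2025, Cor. 5.1: discharge of `DeRosaDrivasInversiIsett2025_cor51`

Barriers/AnomalousDissipation: discharge file for the named fact
`Literature.Barriers.AnomalousDissipation.DeRosaDrivasInversiIsett2025_cor51`
(`IntermittentDissipation`): smooth unforced Navier–Stokes families `u_j` on `T^d × (0,T)`,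
`d ≥ 2`, with `ν_j → 0`, the interior zeroth law and dissipation measures `ν_j|∇u_j|² ⇀ D`, whose
limiting dissipation is carried inside the slab by an `H^s`-null set `S`, are not bounded in
`L^p(0,T; B^σ_{p,∞})` when `2σ/(1-σ) > 1 - ((p-3)/p)(d+1-s)` (L. De Rosa, T. D. Drivas,
M. Inversi, P. Isett, *Intermittency and dissipation regularity in turbulence*, preprint dated
17 Feb 2025, Cor. 5.1 with Thm. 1.1(i) and Cor. 1.2).

## The proof

The Navier–Stokes passage is the printed one (op. cit. §5.1, referring to De Rosa–Isett 2024,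
§6.1) and is entirely the tree's: a bounded family has, by the Aubin–Lions–Simon step
`DeRosaIsett2024_s61_compactness_holds`, a subsequence converging strongly in `L³_{t,x}` to a weak
Euler solution `v ∈ L^p_t B^σ_{p,∞}` (`DeRosaIsett2024.memLpBesovSup_of_tendsto_L3`) with an
`L^{3/2}` pressure whose Duchon–Robert functional is `ψ ↦ ∫ ψ dD`
(`DeRosaIsett2024.hasLocalEnergyBalance_of_inviscidLimit`, fed with the Calderón–Zygmund pressure
`DeRosaIsett2024.exists_pressure_of_tendsto_L3_all`), and `D` charges a compact sub-slab
`[ε₀, T'] × T^d` by the interior zeroth law (`DeRosaIsett2024.exists_test_ofMeasure_pos`); since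
`D` gives no mass to the slab off `S`, it charges the `H^s`-null set `([ε₀,T'] × T^d) ∩ S`,
contradicting the Euler-side statement.

The Euler-side statement is Thm. 1.1(i) of the source for the non-negative measure `D`:
`D(A) = 0` for every `H^s`-null `A` in a compact sub-slab, under the printed exponent relation
(1.2). The printed proof (op. cit. §3, Steps 1–2: negative Besov regularity of `D` by
Littlewood–Paley, duality `B^{-α}_{b,∞} = (B^α_{b',1})^*`, sub-additivity of fractional Sobolev
norms on maxima of cut-offs, interpolation) is replaced here by an elementary covering argument
giving the same exponents, built on the tree's discharge of De Rosa–Isett's §5.1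
(`IntermittentDissipationFinalBound`):

* `DeRosaDrivasInversiIsett2025.localizedFluxBound` — the symmetric Duchon–Robert form of the
  mollification estimate of Prop. 1.4 with the localization set kept explicit: for a test `φ`
  supported in `(0,T)` there is `M` with
  `|D(φχ) + D((φχ) ⋆ₓ k_ε)| ≤ M (ε^{3σ-1} + ε^{2σ}/ρ) |(Z)_{4ρ} ∩ ((0,T) × T^d)|^{1-3/p}` for
  every set `Z`, every `ρ ∈ (0,1]`, `ε ∈ (0,1/4]`, `χ` the space–time cut-off of `Z` at scale `ρ`
  (De Rosa–Isett's Lemma 5.2, `Torus.exists_spaceTime_cutoff`) — the four Hölder bounds of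
  `DeRosaIsett2024_s51_finalBound_holds` verbatim, without the Minkowski hypothesis;
* `DeRosaDrivasInversiIsett2025.measure_eq_zero_of_localizedFluxBound` — for `D = μ ≥ 0`, testing
  with the time cut-off `φ` (both `φχ` and `(φχ) ⋆ₓ k_ε` are non-negative, so
  `μ(⋃_{z∈Z} B_ρ(z)) ≤ ∫ φχ dμ ≤ D(φχ) + D((φχ) ⋆ₓ k_ε)`), the choice `ε = ρ^{1/(1-σ)}` of the
  source and `|B_ρ| ≤ (2ρ)^{d+1}` give
  `μ(⋃_{z∈Z} B_ρ(z)) ≲ (#Z)^{1-3/p} ρ^{(d+1)(1-3/p) + 2σ/(1-σ) - 1}` for finite `Z`;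
* `DeRosaDrivasInversiIsett2025.measure_eq_zero_of_hausdorffMeasure_eq_zero` — the covering lemma
  (a Frostman-type lemma with a Hölder gain): such a bound with `(#Z)^e ρ^λ`, `λ > s e`, forces
  `μ(A) = 0` whenever `H^s(A) = 0`, by grouping a Hausdorff cover of `A` dyadically by diameter —
  the `N_k` pieces of diameter `∼ 2^{-k}` cost `N_k^e 2^{-kλ}` with `N_k ≲ 2^{ks}`, summable in `k`
  exactly under the strict inequality (1.2); this dyadic grouping is where the factor `(p-3)/p` on
  the codimension `d+1-s` comes from.

The case `p = ∞` is reduced to a large finite exponent as in the tree's proof of Thm. 2.13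
(`DeRosaIsett2024.exists_finite_exponent`, `DeRosaIsett2024.eLpBesovSupNorm_le_top_mul`).

## References

* L. De Rosa, T. D. Drivas, M. Inversi, P. Isett, *Intermittency and dissipation regularity in
  turbulence*, preprint dated 17 Feb 2025 (lit key `paper:galaxy-pdf-4976714548344844440`; read:
  Abstract, Thm. 1.1, Cor. 1.2, Prop. 1.3–1.4, §2.1 Lemma 2.1 and Cor. 2.2, §2.3–2.4, Prop. 3.1,
  the proofs of Prop. 1.4, of Thm. 1.1 (Steps 0–3) and of Cor. 1.2 in §3, Rem. 3.2, Cor. 4.1,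
  §5.1 with Cor. 5.1 and (5.1)). [DeRosaDrivasInversiIsett2025]
* L. De Rosa, P. Isett, Arch. Ration. Mech. Anal. 248 (2024), Paper No. 11 = arXiv:2212.08176,
  Lemma 5.2, §5.1, §6.1. [DeRosaIsett2024]
-/

noncomputable section

open MeasureTheory TopologicalSpace Set Function Filter Metric
open _root_.Topology
open scoped ENNReal NNReal Convolution InnerProductSpace RealInnerProductSpace ContDiff

namespace Literature.Barriers.AnomalousDissipation

namespace DeRosaDrivasInversiIsett2025

/-! ## The covering lemma -/

section Cover

variable {X : Type*} [MetricSpace X] [MeasurableSpace X] [BorelSpace X]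

/-- **Covers extracted from `H^s(A) = 0`.** If `μH[s] A = 0` then for every `r > 0` and `η > 0`
there is a countable cover of `A` by sets of diameter `≤ r` with `∑ₙ diam(tₙ)^s < η` (the
Carathéodory construction, Mathlib's `hausdorffMeasure_apply`). [folklore] -/
theorem exists_cover_of_hausdorffMeasure_eq_zero {s : ℝ} {A : Set X} (hH : μH[s] A = 0)
    {r η : ℝ≥0∞} (hr : 0 < r) (hη : 0 < η) :
    ∃ t : ℕ → Set X, A ⊆ ⋃ n, t n ∧ (∀ n, ediam (t n) ≤ r) ∧
      ∑' n, ⨆ _ : (t n).Nonempty, ediam (t n) ^ s < η := by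
  have h0 : ⨅ (t : ℕ → Set X) (_ : A ⊆ ⋃ n, t n) (_ : ∀ n, ediam (t n) ≤ r),
      ∑' n, ⨆ _ : (t n).Nonempty, ediam (t n) ^ s ≤ 0 := by
    have h := Measure.hausdorffMeasure_apply s A
    rw [hH] at h
    calc ⨅ (t : ℕ → Set X) (_ : A ⊆ ⋃ n, t n) (_ : ∀ n, ediam (t n) ≤ r),
          ∑' n, ⨆ _ : (t n).Nonempty, ediam (t n) ^ s
        ≤ ⨆ (r : ℝ≥0∞) (_ : 0 < r), ⨅ (t : ℕ → Set X) (_ : A ⊆ ⋃ n, t n)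
            (_ : ∀ n, ediam (t n) ≤ r), ∑' n, ⨆ _ : (t n).Nonempty, ediam (t n) ^ s :=
          le_iSup₂ (f := fun (r : ℝ≥0∞) (_ : 0 < r) => ⨅ (t : ℕ → Set X) (_ : A ⊆ ⋃ n, t n)
            (_ : ∀ n, ediam (t n) ≤ r), ∑' n, ⨆ _ : (t n).Nonempty, ediam (t n) ^ s) r hr
      _ = 0 := h.symm
  obtain ⟨t, ht⟩ := iInf_lt_iff.1 (lt_of_le_of_lt h0 hη)
  obtain ⟨hA, ht⟩ := iInf_lt_iff.1 ht
  obtain ⟨hd, ht⟩ := iInf_lt_iff.1 ht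
  exact ⟨t, hA, hd, ht⟩

/-- **A Frostman-type covering lemma with a Hölder gain.** Let `μ` be a measure on a metric space,
`A` a set, `0 ≤ s`, `0 ≤ e`, `s·e < λ`, `ρ₀ > 0`, `M ≥ 0`, and suppose that for every dyadic scale
`ρ_k = ρ₀ 2^{-k}` and every finite set `Z ⊆ A` of centres
`μ(⋃_{z ∈ Z} B(z, ρ_k)) ≤ M · (#Z)^e · ρ_k^λ`. If `H^s(A) = 0` then `μ(A) = 0`.
(Proof: cover `A` by sets of diameter `≤ ρ_{k₀+2}` with `∑ diam^s < 1`; pieces of zero diameter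
are points of `A`, which are not atoms since `λ > 0`; the pieces of diameter in
`(ρ_{k+2}, ρ_{k+1}]` are at most `ρ_{k+2}^{-s}` in number and lie in balls of radius `ρ_k` centred
in `A`, so they carry mass `≲ ρ_k^{λ - se}`, summable over `k > k₀`; let `k₀ → ∞`.) This is the
covering step replacing Step 2 of the proof of Thm. 1.1 of De Rosa–Drivas–Inversi–Isett (2025),
with the dyadic grouping supplying the factor `(#Z)^e`. [folklore] -/
theorem measure_eq_zero_of_hausdorffMeasure_eq_zero (μ : Measure X) {A : Set X}
    {s e lam M ρ₀ : ℝ} (hs : 0 ≤ s) (he : 0 ≤ e) (hM : 0 ≤ M) (hρ₀ : 0 < ρ₀) (hlam : s * e < lam)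
    (hbound : ∀ (k : ℕ) (Z : Finset X), (↑Z : Set X) ⊆ A →
      μ (⋃ z ∈ Z, ball z (ρ₀ * 2⁻¹ ^ k)) ≤
        ENNReal.ofReal (M * (Z.card : ℝ) ^ e * (ρ₀ * 2⁻¹ ^ k) ^ lam))
    (hH : μH[s] A = 0) : μ A = 0 := by
  classical
  rcases A.eq_empty_or_nonempty with rfl | ⟨x₀, hx₀⟩
  · exact measure_empty
  have hse : 0 ≤ s * e := mul_nonneg hs he
  have hlam0 : 0 < lam := hse.trans_lt hlam
  set β : ℝ := lam - s * e with hβ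
  have hβ0 : 0 < β := sub_pos.2 hlam
  -- dyadic scales
  set ρ : ℕ → ℝ := fun k => ρ₀ * 2⁻¹ ^ k with hρ
  have hρpos : ∀ k, 0 < ρ k := fun k => mul_pos hρ₀ (pow_pos (by norm_num) k)
  have hρsucc : ∀ k, ρ (k + 1) = ρ k * 2⁻¹ := fun k => by
    simp only [hρ, pow_succ]; ring
  have hρtwo : ∀ k, ρ (k + 2) = ρ k * 4⁻¹ := fun k => by
    rw [hρsucc, hρsucc]; ring
  have hρanti : ∀ {k l : ℕ}, k ≤ l → ρ l ≤ ρ k := fun {k l} hkl => by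
    simp only [hρ]
    exact mul_le_mul_of_nonneg_left (pow_le_pow_of_le_one (by norm_num) (by norm_num) hkl) hρ₀.le
  have hρlt : ∀ k, ρ (k + 1) < ρ k := fun k => by
    rw [hρsucc]; linarith [hρpos k]
  have hρle : ∀ k, ρ k ≤ ρ₀ := fun k => by
    have := hρanti (Nat.zero_le k); simpa [hρ] using this
  ---------------------------------------------------------------------------------------------
  -- Step 1: points of `A` are not atoms
  ---------------------------------------------------------------------------------------------
  have hpowlim : Tendsto (fun k : ℕ => (ρ k) ^ lam) atTop (𝓝 0) := by
    have h1 : Tendsto ρ atTop (𝓝 0) := by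
      have := (tendsto_pow_atTop_nhds_zero_of_lt_one (r := (2⁻¹ : ℝ)) (by norm_num)
        (by norm_num)).const_mul ρ₀
      simpa [hρ] using this
    have h2 : Tendsto (fun x : ℝ => x ^ lam) (𝓝 0) (𝓝 0) := by
      have := (Real.continuousAt_rpow_const 0 lam (Or.inr hlam0.le)).tendsto
      rwa [Real.zero_rpow hlam0.ne'] at this
    exact h2.comp h1
  have hatom : ∀ z ∈ A, μ {z} = 0 := by
    intro z hz
    have hle : ∀ k : ℕ, μ {z} ≤ ENNReal.ofReal (M * (ρ k) ^ lam) := by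
      intro k
      have h := hbound k {z} (by simpa using hz)
      simp only [Finset.card_singleton, Nat.cast_one, Real.one_rpow, mul_one,
        Finset.mem_singleton, iUnion_iUnion_eq_left] at h
      exact (measure_mono (singleton_subset_iff.2 (mem_ball_self (hρpos k)))).trans h
    have htend : Tendsto (fun k : ℕ => ENNReal.ofReal (M * (ρ k) ^ lam)) atTop (𝓝 0) := by
      have := ENNReal.tendsto_ofReal (hpowlim.const_mul M)
      simpa using this
    exact le_antisymm (ge_of_tendsto' htend hle) bot_le
  ---------------------------------------------------------------------------------------------
  -- Step 2: the geometric bound `μ A ≤ C₀ x^{k₀+1}/(1-x)` for every `k₀`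
  ---------------------------------------------------------------------------------------------
  set x : ℝ := (2⁻¹ : ℝ) ^ β with hx
  have hx0 : 0 < x := Real.rpow_pos_of_pos (by norm_num) β
  have hx1 : x < 1 := Real.rpow_lt_one (by norm_num) (by norm_num) hβ0
  set C₀ : ℝ := M * (4⁻¹ : ℝ) ^ (-(s * e)) * ρ₀ ^ β with hC₀
  have hC₀0 : 0 ≤ C₀ := by rw [hC₀]; positivity
  -- the per-scale bound in closed form
  have hscale : ∀ (k : ℕ) (c : ℝ), 0 ≤ c → c * (ρ (k + 2)) ^ s ≤ 1 →
      M * c ^ e * (ρ k) ^ lam ≤ C₀ * x ^ k := by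
    intro k c hc0 hc
    have hρk := hρpos k
    have h1 : c ≤ (ρ (k + 2)) ^ (-s) := by
      rw [Real.rpow_neg (hρpos _).le, inv_eq_one_div, le_div_iff₀ (Real.rpow_pos_of_pos (hρpos _) _)]
      exact hc
    have h2 : c ^ e ≤ (ρ k) ^ (-(s * e)) * (4⁻¹ : ℝ) ^ (-(s * e)) := by
      calc c ^ e ≤ ((ρ (k + 2)) ^ (-s)) ^ e := Real.rpow_le_rpow hc0 h1 he
        _ = (ρ k * 4⁻¹) ^ (-(s * e)) := by
            rw [hρtwo, ← Real.rpow_mul (by positivity)]; ring_nf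
        _ = (ρ k) ^ (-(s * e)) * (4⁻¹ : ℝ) ^ (-(s * e)) := Real.mul_rpow hρk.le (by norm_num)
    have h3 : (ρ k) ^ lam = (ρ k) ^ (s * e) * ((ρ₀ ^ β) * x ^ k) := by
      have e1 : (ρ k) ^ lam = (ρ k) ^ (s * e) * (ρ k) ^ β := by
        rw [← Real.rpow_add hρk]; congr 1; ring
      have e2 : (ρ k) ^ β = ρ₀ ^ β * x ^ k := by
        simp only [hρ, hx]
        rw [Real.mul_rpow hρ₀.le (by positivity), ← Real.rpow_natCast,
          ← Real.rpow_mul (by norm_num), mul_comm (k : ℝ) β, Real.rpow_mul (by norm_num),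
          Real.rpow_natCast]
      rw [e1, e2]
    calc M * c ^ e * (ρ k) ^ lam
        ≤ M * ((ρ k) ^ (-(s * e)) * (4⁻¹ : ℝ) ^ (-(s * e))) * (ρ k) ^ lam := by
          gcongr
      _ = M * (4⁻¹ : ℝ) ^ (-(s * e)) * ρ₀ ^ β * x ^ k * ((ρ k) ^ (-(s * e)) * (ρ k) ^ (s * e)) := by
          rw [h3]; ring
      _ = C₀ * x ^ k := by
          rw [← Real.rpow_add hρk, neg_add_cancel, Real.rpow_zero, mul_one]
  have key : ∀ k₀ : ℕ, μ A ≤ ENNReal.ofReal (C₀ * x ^ (k₀ + 1) / (1 - x)) := by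
    intro k₀
    -- a cover by sets of diameter `≤ ρ (k₀+2)` with `∑ diam^s < 1`
    obtain ⟨t, hAt, hdiam, hsum⟩ := exists_cover_of_hausdorffMeasure_eq_zero hH
      (r := ENNReal.ofReal (ρ (k₀ + 2))) (η := 1) (ENNReal.ofReal_pos.2 (hρpos _)) one_pos
    have htop : ∀ n, ediam (t n) ≠ ⊤ := fun n =>
      ((hdiam n).trans_lt ENNReal.ofReal_lt_top).ne
    set δ : ℕ → ℝ := fun n => (ediam (t n)).toReal with hδ
    have hδ0 : ∀ n, 0 ≤ δ n := fun n => ENNReal.toReal_nonneg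
    have hδle : ∀ n, δ n ≤ ρ (k₀ + 2) := fun n =>
      ENNReal.toReal_le_of_le_ofReal (hρpos _).le (hdiam n)
    have hδof : ∀ n, ENNReal.ofReal (δ n) = ediam (t n) := fun n => ENNReal.ofReal_toReal (htop n)
    -- centres in `A`
    set z : ℕ → X := fun n => if h : (t n ∩ A).Nonempty then h.some else x₀ with hz
    have hzmem : ∀ n, (t n ∩ A).Nonempty → z n ∈ t n ∧ z n ∈ A := fun n hn => by
      simp only [hz, dif_pos hn]; exact hn.some_mem
    have hsub : ∀ n, (t n ∩ A).Nonempty → ∀ r' : ℝ, δ n < r' → t n ⊆ ball (z n) r' := by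
      intro n hn r' hlt y hy
      rw [mem_ball]
      have h1 : edist y (z n) ≤ ediam (t n) := edist_le_ediam_of_mem hy (hzmem n hn).1
      rw [edist_dist] at h1
      exact ((ENNReal.ofReal_le_iff_le_toReal (htop n)).1 h1).trans_lt hlt
    -- the dyadic groups
    set G : ℕ → Set ℕ := fun k => {n | (t n ∩ A).Nonempty ∧ ρ (k + 2) < δ n ∧ δ n ≤ ρ (k + 1)}
      with hG
    -- zero-diameter pieces meeting `A` are null
    set P₀ : Set ℕ := {n | (t n ∩ A).Nonempty ∧ δ n = 0} with hP₀
    have hP₀null : μ (⋃ n ∈ P₀, t n) = 0 := by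
      refine (measure_biUnion_null_iff (to_countable P₀)).2 fun n hn => ?_
      have hsing : (t n).Subsingleton := by
        rw [← ediam_eq_zero_iff, ← hδof n, hn.2, ENNReal.ofReal_zero]
      have hsub1 : t n ⊆ {z n} := fun y hy =>
        mem_singleton_iff.2 (hsing hy (hzmem n hn.1).1)
      exact measure_mono_null hsub1 (hatom _ (hzmem n hn.1).2)
    -- every point of `A` lies in a zero-diameter piece or in some group
    have hcover : A ⊆ (⋃ n ∈ P₀, t n) ∪ ⋃ k, ⋃ n ∈ G k, t n := by
      intro y hy
      obtain ⟨n, hn⟩ := mem_iUnion.1 (hAt hy)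
      have hnA : (t n ∩ A).Nonempty := ⟨y, hn, hy⟩
      rcases (hδ0 n).eq_or_lt with h0 | hpos
      · exact Or.inl (mem_biUnion (show n ∈ P₀ from ⟨hnA, h0.symm⟩) hn)
      · right
        -- `ρ₀/(2 δ n) ≥ 1`: find `m` with `2^m ≤ ρ₀/(2δ) < 2^{m+1}`
        have hX : 1 ≤ ρ 1 / δ n := by
          rw [le_div_iff₀ hpos, one_mul]
          exact (hδle n).trans (hρanti (by omega))
        obtain ⟨m, hm1, hm2⟩ := exists_nat_pow_near hX one_lt_two
        refine mem_iUnion.2 ⟨m, mem_biUnion (show n ∈ G m from ⟨hnA, ?_, ?_⟩) hn⟩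
        · -- `ρ (m+2) < δ n` from `ρ 1 / δ n < 2^(m+1)`
          rw [div_lt_iff₀ hpos, mul_comm] at hm2
          have e1 : ρ (m + 2) * 2 ^ (m + 1) = ρ 1 := by
            simp only [hρ, inv_pow]; field_simp; ring
          by_contra hcon
          have : δ n * 2 ^ (m + 1) ≤ ρ 1 := by
            rw [← e1]; exact mul_le_mul_of_nonneg_right (not_lt.1 hcon) (by positivity)
          linarith
        · -- `δ n ≤ ρ (m+1)` from `2^m ≤ ρ 1 / δ n`
          rw [le_div_iff₀ hpos, mul_comm] at hm1
          have e1 : ρ (m + 1) * 2 ^ m = ρ 1 := by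
            simp only [hρ, inv_pow]; field_simp; ring
          by_contra hcon
          have : ρ 1 < δ n * 2 ^ m := by
            rw [← e1]; exact mul_lt_mul_of_pos_right (not_le.1 hcon) (by positivity)
          linarith
    -- groups below `k₀` are empty
    have hGempty : ∀ k, k ≤ k₀ → G k = ∅ := by
      intro k hk
      refine eq_empty_iff_forall_notMem.2 fun n hn => ?_
      have h1 : ρ (k + 2) < ρ (k₀ + 2) := hn.2.1.trans_le (hδle n)
      exact absurd (hρanti (show k + 2 ≤ k₀ + 2 by omega)) (not_le.2 h1)
    -- each group is finite, with at most `ρ_{k+2}^{-s}` members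
    set a : ℕ → ℝ≥0∞ := fun n => ⨆ _ : (t n).Nonempty, ediam (t n) ^ s with ha
    have hane : ∑' n, a n ≠ ⊤ := (hsum.trans ENNReal.one_lt_top).ne
    have hGsub : ∀ k, G k ⊆ {n | ENNReal.ofReal (ρ (k + 2)) ^ s ≤ a n} := by
      intro k n hn
      have hne : (t n).Nonempty := hn.1.mono inter_subset_left
      show ENNReal.ofReal (ρ (k + 2)) ^ s ≤ ⨆ _ : (t n).Nonempty, ediam (t n) ^ s
      rw [iSup_pos hne, ← hδof n]
      exact ENNReal.rpow_le_rpow (ENNReal.ofReal_le_ofReal hn.2.1.le) hs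
    have hcpos : ∀ k, ENNReal.ofReal (ρ (k + 2)) ^ s ≠ 0 := fun k =>
      (ENNReal.rpow_pos (ENNReal.ofReal_pos.2 (hρpos _)) ENNReal.ofReal_ne_top).ne'
    have hGfin : ∀ k, (G k).Finite := fun k =>
      (ENNReal.finite_const_le_of_tsum_ne_top hane (hcpos k)).subset (hGsub k)
    have hcard : ∀ k, ((hGfin k).toFinset.card : ℝ) * (ρ (k + 2)) ^ s ≤ 1 := by
      intro k
      set F := (hGfin k).toFinset with hF
      have h1 : (F.card : ℝ≥0∞) * ENNReal.ofReal (ρ (k + 2)) ^ s ≤ 1 := by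
        calc (F.card : ℝ≥0∞) * ENNReal.ofReal (ρ (k + 2)) ^ s
            = ∑ n ∈ F, ENNReal.ofReal (ρ (k + 2)) ^ s := by rw [Finset.sum_const, nsmul_eq_mul]
          _ ≤ ∑ n ∈ F, a n := Finset.sum_le_sum fun n hn => hGsub k ((hGfin k).mem_toFinset.1 hn)
          _ ≤ ∑' n, a n := ENNReal.sum_le_tsum F
          _ ≤ 1 := hsum.le
      have h2 : ((F.card : ℝ≥0∞) * ENNReal.ofReal (ρ (k + 2)) ^ s).toReal ≤ (1 : ℝ≥0∞).toReal :=
        ENNReal.toReal_mono ENNReal.one_ne_top h1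
      rwa [ENNReal.toReal_mul, ENNReal.toReal_natCast, ENNReal.ofReal_rpow_of_pos (hρpos _),
        ENNReal.toReal_ofReal (Real.rpow_nonneg (hρpos _).le _), ENNReal.toReal_one] at h2
    -- the mass of each group
    have hgroup : ∀ k, μ (⋃ n ∈ G k, t n) ≤ ENNReal.ofReal (C₀ * x ^ k) := by
      intro k
      set F := (hGfin k).toFinset with hF
      set Z : Finset X := F.image z with hZ
      have hZA : (↑Z : Set X) ⊆ A := by
        intro w hw
        rw [Finset.mem_coe, hZ, Finset.mem_image] at hw
        obtain ⟨n, hn, rfl⟩ := hw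
        exact (hzmem n ((hGfin k).mem_toFinset.1 hn).1).2
      have hU : (⋃ n ∈ G k, t n) ⊆ ⋃ w ∈ Z, ball w (ρ k) := by
        intro y hy
        obtain ⟨n, hn, hyn⟩ := mem_iUnion₂.1 hy
        have hball := hsub n hn.1 (ρ k) (hn.2.2.trans_lt (hρlt k)) hyn
        refine mem_iUnion₂.2 ⟨z n, ?_, hball⟩
        rw [hZ, Finset.mem_image]
        exact ⟨n, (hGfin k).mem_toFinset.2 hn, rfl⟩
      have hcardZ : (Z.card : ℝ) ≤ F.card := by exact_mod_cast Finset.card_image_le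
      calc μ (⋃ n ∈ G k, t n) ≤ μ (⋃ w ∈ Z, ball w (ρ k)) := measure_mono hU
        _ ≤ ENNReal.ofReal (M * (Z.card : ℝ) ^ e * (ρ k) ^ lam) := hbound k Z hZA
        _ ≤ ENNReal.ofReal (M * (F.card : ℝ) ^ e * (ρ k) ^ lam) := by
            refine ENNReal.ofReal_le_ofReal ?_
            gcongr
        _ ≤ ENNReal.ofReal (C₀ * x ^ k) :=
            ENNReal.ofReal_le_ofReal (hscale k _ (Nat.cast_nonneg _) (hcard k))
    -- summing the groups over `k > k₀`
    set U : ℕ → Set X := fun k => ⋃ n ∈ G k, t n with hU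
    have hUzero : ∀ k, k ≤ k₀ → μ (U k) = 0 := fun k hk => by
      have hUk : U k = ∅ := by
        show (⋃ n ∈ G k, t n) = ∅
        rw [hGempty k hk]
        exact biUnion_empty _
      rw [hUk, measure_empty]
    have hsumU : ∑' k, μ (U k) ≤ ENNReal.ofReal (C₀ * x ^ (k₀ + 1) / (1 - x)) := by
      have hshift : ((∑ i ∈ Finset.range (k₀ + 1), μ (U i)) + ∑' i, μ (U (i + (k₀ + 1)))) =
          ∑' i, μ (U i) :=
        Summable.sum_add_tsum_nat_add' (f := fun k => μ (U k)) (k := k₀ + 1) ENNReal.summable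
      rw [← hshift, Finset.sum_eq_zero (fun k hk => hUzero k (by
        have := Finset.mem_range.1 hk; omega)), zero_add]
      have hgeo : HasSum (fun k : ℕ => C₀ * x ^ (k₀ + 1) * x ^ k) (C₀ * x ^ (k₀ + 1) / (1 - x)) := by
        have := (hasSum_geometric_of_lt_one hx0.le hx1).mul_left (C₀ * x ^ (k₀ + 1))
        simpa [div_eq_mul_inv] using this
      calc ∑' k, μ (U (k + (k₀ + 1))) ≤ ∑' k, ENNReal.ofReal (C₀ * x ^ (k₀ + 1) * x ^ k) := by
            refine ENNReal.tsum_le_tsum fun k => (hgroup _).trans (le_of_eq ?_)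
            congr 1
            rw [pow_add]; ring
        _ = ENNReal.ofReal (C₀ * x ^ (k₀ + 1) / (1 - x)) := by
            rw [← hgeo.tsum_eq]
            exact (ENNReal.ofReal_tsum_of_nonneg (fun k => by positivity) hgeo.summable).symm
    calc μ A ≤ μ ((⋃ n ∈ P₀, t n) ∪ ⋃ k, U k) := measure_mono hcover
      _ ≤ μ (⋃ n ∈ P₀, t n) + μ (⋃ k, U k) := measure_union_le _ _
      _ ≤ 0 + ∑' k, μ (U k) := add_le_add hP₀null.le (measure_iUnion_le _)
      _ ≤ ENNReal.ofReal (C₀ * x ^ (k₀ + 1) / (1 - x)) := by rw [zero_add]; exact hsumU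
  ---------------------------------------------------------------------------------------------
  -- Step 3: `k₀ → ∞`
  ---------------------------------------------------------------------------------------------
  have htend : Tendsto (fun k₀ : ℕ => ENNReal.ofReal (C₀ * x ^ (k₀ + 1) / (1 - x))) atTop (𝓝 0) := by
    have h1 : Tendsto (fun k₀ : ℕ => x ^ (k₀ + 1)) atTop (𝓝 0) :=
      (tendsto_pow_atTop_nhds_zero_of_lt_one hx0.le hx1).comp (tendsto_add_atTop_nat 1)
    have h2 : Tendsto (fun k₀ : ℕ => C₀ * x ^ (k₀ + 1) / (1 - x)) atTop (𝓝 (C₀ * 0 / (1 - x))) :=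
      (h1.const_mul C₀).div_const (1 - x)
    rw [mul_zero, zero_div] at h2
    simpa using ENNReal.tendsto_ofReal h2
  exact le_antisymm (ge_of_tendsto' htend key) bot_le

end Cover

/-! ## Volumes of sup-metric balls in `ℝ × T^d` -/

/-- The volume of a (sup-metric) ball of radius `r > 0` in `ℝ × T^d` is at most `(2r)^{d+1}`: the
ball is an interval of length `2r` times a product of `d` arcs of length `min(1, 2r)`
(`Real.volume_ball`, `volume_pi_closedBall`, `AddCircle.volume_closedBall`). [folklore] -/
theorem volume_ball_le {d : Type*} [Fintype d] (z : ℝ × UnitAddTorus d) {r : ℝ} (hr : 0 < r) :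
    volume (ball z r) ≤ ENNReal.ofReal ((2 * r) ^ (Fintype.card d + 1)) := by
  rw [← ball_prod_same, Measure.volume_eq_prod, Measure.prod_prod, Real.volume_ball]
  have h2 : volume (ball z.2 r) ≤ ENNReal.ofReal ((2 * r) ^ Fintype.card d) := by
    calc volume (ball z.2 r) ≤ volume (closedBall z.2 r) := measure_mono ball_subset_closedBall
      _ = ∏ i, volume (closedBall (z.2 i) r) := volume_pi_closedBall z.2 hr.le
      _ ≤ ∏ _i : d, ENNReal.ofReal (2 * r) := by
          refine Finset.prod_le_prod' fun i _ => ?_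
          rw [AddCircle.volume_closedBall]
          exact ENNReal.ofReal_le_ofReal (min_le_right _ _)
      _ = ENNReal.ofReal ((2 * r) ^ Fintype.card d) := by
          rw [Finset.prod_const, Finset.card_univ, ENNReal.ofReal_pow (by positivity)]
  calc ENNReal.ofReal (2 * r) * volume (ball z.2 r)
      ≤ ENNReal.ofReal (2 * r) * ENNReal.ofReal ((2 * r) ^ Fintype.card d) := by gcongr
    _ = ENNReal.ofReal ((2 * r) ^ (Fintype.card d + 1)) := by
        rw [← ENNReal.ofReal_mul (by positivity), pow_succ']

/-- Finite unions of balls of radius `r` centred in a finite set `Z ⊆ ℝ × T^d` have volume at most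
`#Z · (2r)^{d+1}`. [folklore] -/
theorem volume_biUnion_ball_le {d : Type*} [Fintype d] (Z : Finset (ℝ × UnitAddTorus d)) {r : ℝ}
    (hr : 0 < r) :
    volume (⋃ z ∈ Z, ball z r) ≤ ENNReal.ofReal ((Z.card : ℝ) * (2 * r) ^ (Fintype.card d + 1)) := by
  calc volume (⋃ z ∈ Z, ball z r) ≤ ∑ z ∈ Z, volume (ball z r) := measure_biUnion_finset_le _ _
    _ ≤ ∑ _z ∈ Z, ENNReal.ofReal ((2 * r) ^ (Fintype.card d + 1)) :=
        Finset.sum_le_sum fun z _ => volume_ball_le z hr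
    _ = ENNReal.ofReal ((Z.card : ℝ) * (2 * r) ^ (Fintype.card d + 1)) := by
        rw [Finset.sum_const, nsmul_eq_mul, ENNReal.ofReal_mul (Nat.cast_nonneg _),
          ENNReal.ofReal_natCast]

/-! ## The Euler-side theorem: `D ≪ H^s` for non-negative Duchon–Robert measures -/

section Flux

open Literature.Analysis.FunctionSpaces Literature.Analysis.FunctionSpaces.Torus
open Literature.Analysis.FluidPDE Literature.Analysis.FluidPDE.Torus

variable {d : Type} [Fintype d] [DecidableEq d]

set_option maxHeartbeats 3200000 in
/-- **The localized symmetric flux bound** (the estimate behind Prop. 1.4 / Step 3 of the proof of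
Thm. 1.1 of De Rosa–Drivas–Inversi–Isett 2025, in the symmetric Duchon–Robert form of the tree and
with the measure of the localization set kept explicit; cf. De Rosa–Isett 2024, §5.1
(fin_est_eps_delt)). Let `(v, p)` be a distributional Euler solution on `T^d × (0,T)` with
`p ∈ L^{3/2}`, `v ∈ L^q(0,T; B^θ_{q,∞})`, `q ∈ [3,∞)`, `θ ∈ (0,1)`, let `D` satisfy the local
energy balance of `(v,p)` and let `φ` be a test function supported in `(0,T)`. There is `M ≥ 0`
such that for every set `Z ⊆ ℝ × T^d`, every `ρ ∈ (0,1]` and every `ε ∈ (0, 1/4]`, with `χ` the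
space–time cut-off of `Z` at scale `ρ` (`χ = 1` on `(Z)_ρ`, `χ = 0` off `(Z)_{3ρ}`,
`|∂ₜχ|, |∇χ| ≲ 1/ρ`),
`|D(φχ) + D((φχ) ⋆ₓ k_ε)| ≤ M (ε^{3θ-1} + ε^{2θ}/ρ) · |(Z)_{4ρ} ∩ ((0,T) × T^d)|^{1 - 3/q}`
(Hölder in `L^{q/3} × L^{(q/3)'}` on `(Z)_{4ρ}` for the flux, transport, Reynolds and pressure
commutator pairings of the symmetric identity
`Torus.two_mul_energyFlux_add_energyFlux_mollified_eq`, with the space–time bounds of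
`DeRosaIsettTermEstimates`). [cite: DeRosaDrivasInversiIsett2025, Prop. 1.4 and §3] -/
theorem localizedFluxBound (hd : 2 ≤ Fintype.card d) {T : ℝ} (hT : 0 < T)
    {v : ℝ → UnitAddTorus d → EuclideanSpace ℝ d} {p : ℝ → UnitAddTorus d → ℝ}
    (hsol : IsDistributionalNSSolutionOn T 0 0 v p)
    (hp : ∫⁻ t in Ioo 0 T, ∫⁻ x, ‖p t x‖ₑ ^ (3 / 2 : ℝ) < ⊤)
    {q : ℝ≥0∞} (hq : 3 ≤ q) (hq' : q ≠ ⊤) {θ : ℝ} (hθ : 0 < θ ∧ θ < 1)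
    (hv : MemLpBesovSup q θ q v volume (Ioo 0 T))
    {D : STFunctional d} (hD : HasLocalEnergyBalance T 0 v p 0 D)
    {φ : ℝ → UnitAddTorus d → ℝ} (hφ : IsSpaceTimeTestIoo T φ) :
    ∃ M : ℝ, 0 ≤ M ∧ ∀ (Z : Set (ℝ × UnitAddTorus d)) (ρ ε : ℝ), 0 < ε → ε ≤ 1 / 4 → 0 < ρ →
      ρ ≤ 1 →
      ∃ χ : ℝ → UnitAddTorus d → ℝ, ContDiff ℝ ∞ (stLift χ) ∧ (∀ t x, 0 ≤ χ t x ∧ χ t x ≤ 1) ∧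
        (∀ z ∈ thickening ρ Z, χ z.1 z.2 = 1) ∧
        |D (fun t x => φ t x * χ t x) +
            D (fun t => (fun x => φ t x * χ t x) ⋆ Torus.kernel ε)| ≤
          M * (ε ^ (3 * θ - 1) + ε ^ (2 * θ) / ρ) *
            ((((volume.restrict (Ioo 0 T)).prod volume) (thickening (4 * ρ) Z)) ^
              (1 - 1 / (q / 3).toReal)).toReal := by
  haveI : Nonempty d := Fintype.card_pos_iff.1 (by omega)
  set n : ℝ := (Fintype.card d : ℝ) with hn
  set μT := (volume.restrict (Ioo 0 T)).prod (volume : Measure (UnitAddTorus d)) with hμT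
  -- integrability classes of the solution
  have hum : AEStronglyMeasurable (uncurry v) μT := aestronglyMeasurable_uncurry_prod hsol.1
  have hpm : AEStronglyMeasurable (uncurry p) μT := aestronglyMeasurable_uncurry_prod hsol.2.2.1
  have hu3 : ∫⁻ t in Ioo 0 T, ∫⁻ x, ‖v t x‖ₑ ^ (3 : ℕ) < ⊤ :=
    lintegral_pow_three_lt_top_of_memLpBesovSup hq hq' hum hv
  have hq0 : q ≠ 0 := (lt_of_lt_of_le (by norm_num) hq).ne'
  have hq2 : 2 < q := lt_of_lt_of_le (by norm_num) hq
  obtain ⟨hr1, hr0, hrt, hr3⟩ := div_three_facts hq hq'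
  have hqq : 0 < q.toReal := ENNReal.toReal_pos hq0 hq'
  -- the `L^q_t B^θ_q` norm
  set N : ℝ≥0∞ := eLpBesovSupNorm q θ q v volume (Ioo 0 T) with hN
  have hNt : N ≠ ⊤ := hv.2.ne
  -- pressure: Besov regularity and slice integrability
  have huq : ∀ᵐ t ∂(volume.restrict (Ioo 0 T)), MemLp (v t) q volume := hv.1.mono fun t ht => ht.memLp
  obtain ⟨Cq, hCq, hP⟩ := hsol.ae_eBesovSupSeminorm_pressure_le hT hq2 hq' huq
  have hPθ : ∀ᵐ t ∂(volume.restrict (Ioo 0 T)), eBesovSupSeminorm θ (q / 2) (p t) volume ≤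
      Cq * eLpNorm (v t) q volume * eBesovSupSeminorm θ q (v t) volume := hP.mono fun t ht => ht θ
  have hpi : ∀ᵐ t ∂(volume.restrict (Ioo 0 T)),
      Integrable (p t) volume ∧ Integrable (fun y => p t y • v t y) volume := by
    obtain ⟨-, -, Iqv⟩ := integrable_normSq_normCube_norm_mul hum hu3 hpm hp
    have hP32 : ∫⁻ z, ‖p z.1 z.2‖ₑ ^ ((3 / 2 : ℝ≥0∞)).toReal ∂μT < ⊤ := by
      have e : ∫⁻ t in Ioo 0 T, ∫⁻ x, ‖p t x‖ₑ ^ (3 / 2 : ℝ) = ∫⁻ z, ‖p z.1 z.2‖ₑ ^ (3 / 2 : ℝ) ∂μT :=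
        lintegral_Ioo_lintegral_eq_lintegral_prod (hpm.enorm.pow_const _)
      have h32 : ((3 / 2 : ℝ≥0∞)).toReal = (3 / 2 : ℝ) := by
        rw [ENNReal.toReal_div]; norm_num
      rw [h32, ← e]
      exact hp
    have hpslice : ∀ᵐ t ∂(volume.restrict (Ioo 0 T)), MemLp (p t) (3 / 2) volume :=
      ae_memLp_slice_of_lintegral (by norm_num) (ENNReal.div_ne_top (by norm_num) (by norm_num)) hpm hP32
    have hvslice : ∀ᵐ t ∂(volume.restrict (Ioo 0 T)), AEStronglyMeasurable (v t) volume := hum.prodMk_left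
    filter_upwards [hpslice, Iqv.prod_right_ae, hvslice] with t hpt hpv hvt
    have hpI : Integrable (p t) volume := hpt.integrable (by
      rw [ENNReal.le_div_iff_mul_le (Or.inl (by norm_num)) (Or.inl (by norm_num))]; norm_num)
    refine ⟨hpI, ?_⟩
    refine hpv.mono' (hpI.aestronglyMeasurable.smul hvt) (ae_of_all _ fun y => ?_)
    rw [norm_smul]
  -- the constants: cut-off, test function
  obtain ⟨Ccut, hCcut0, hcut⟩ := Torus.exists_spaceTime_cutoff (d := d)
  obtain ⟨hφs, hdt, hgr, -⟩ := hφ.isSpaceTimeTest.isSmoothSpaceTimeOn_derived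
  obtain ⟨⟨C0, hC00, hC0⟩, -⟩ := hφs.bound_and_measurable T
  obtain ⟨⟨C1, hC10, hC1⟩, -⟩ := hdt.bound_and_measurable T
  obtain ⟨⟨C2, hC20, hC2⟩, -⟩ := hgr.bound_and_measurable T
  -- real constants
  set NR : ℝ := N.toReal with hNR
  set C₁ : ℝ := Torus.gradProfileMass d with hC₁
  set KT : ℝ := ((N ^ q.toReal + ENNReal.ofReal T) ^ (1 / (q / 3).toReal)).toReal with hKT
  set CqR : ℝ := Cq.toReal with hCqR
  set b1 : ℝ := C1 + C0 * Ccut + (C2 + C0 * Ccut) with hb1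
  set cD : ℝ := C0 * (C₁ * NR ^ 3) with hcD
  set cT : ℝ := b1 * KT with hcT
  set cX : ℝ := b1 * NR ^ 3 with hcX
  set cC : ℝ := b1 * (CqR * NR ^ 3) with hcC
  set M : ℝ := 2⁻¹ * cD + 2⁻¹ * cT + 2⁻¹ * cX + cC with hM
  have hC₁0 : 0 ≤ C₁ := Torus.gradProfileMass_nonneg (d := d)
  have hNR0 : 0 ≤ NR := ENNReal.toReal_nonneg
  have hKT0 : 0 ≤ KT := ENNReal.toReal_nonneg
  have hCqR0 : 0 ≤ CqR := ENNReal.toReal_nonneg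
  have hb10 : 0 ≤ b1 := by rw [hb1]; positivity
  have hcD0 : 0 ≤ cD := by rw [hcD]; positivity
  have hcT0 : 0 ≤ cT := by rw [hcT]; positivity
  have hcX0 : 0 ≤ cX := by rw [hcX]; positivity
  have hcC0 : 0 ≤ cC := by rw [hcC]; positivity
  have hM0 : 0 ≤ M := by rw [hM]; positivity
  refine ⟨M, hM0, fun Z ρ ε hε hε' hρ hρ1 => ?_⟩
  set δ : ℝ := ρ with hδdef
  have hδ : 0 < δ := hρ
  have hδ1 : δ ≤ 1 := hρ1
  set K := Torus.kernel (d := d) ε with hKdef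
  have hK : Torus.IsSmooth K := Torus.isSmooth_kernel hε hε'
  have hKi : Integrable K volume := (Torus.continuous_kernel hε hε').integrable_unitAddTorus
  -- the cut-off at scale `δ` and the localized test `ψ₁ = φ χ`
  obtain ⟨χ, hχs, hχ01, hχ1, hχ0, hχt, hχx⟩ := hcut Z δ hδ
  refine ⟨χ, hχs, hχ01, hχ1, ?_⟩
  set ψ₁ : ℝ → UnitAddTorus d → ℝ := fun t x => φ t x * χ t x with hψ₁
  have hψ₁T : IsSpaceTimeTestIoo T ψ₁ := hφ.mul_smooth hχs
  have hψ₁εT : IsSpaceTimeTestIoo T (fun t => ψ₁ t ⋆ K) := by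
    rw [conv_kernel_comm]; exact isSpaceTimeTestIoo_kernel_conv hψ₁T hKi
  ---------------------------------------------------------------------------------------------
  -- Step 1: `D ψ₁ + D ψ₁ε = 𝓔 ψ₁ + 𝓔 ψ₁ε` and the symmetric identity
  ---------------------------------------------------------------------------------------------
  have hDE : ∀ ψ, IsSpaceTimeTestIoo T ψ → D ψ = energyFluxFunctional T v p ψ :=
    fun ψ hψ => (hD.energyFluxFunctional_eq hψ).symm
  have hid := two_mul_energyFlux_add_energyFlux_mollified_eq hsol hu3 hp hε hε' hψ₁T
  set ID : ℝ := ∫ z, kernelFlux K (v z.1) z.2 * ψ₁ z.1 z.2 ∂μT with hID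
  set ωK : ℝ → UnitAddTorus d → ℝ := fun t x => ‖v t x‖ ^ 2 + ((fun y => ‖v t y‖ ^ 2) ⋆ K) x -
    2 * ⟪v t x, vecConv (v t) K x⟫ with hω
  set CK : ℝ → UnitAddTorus d → EuclideanSpace ℝ d := fun t x => vecConv (fun y => p t y • v t y) K x +
    p t x • v t x - p t x • vecConv (v t) K x - (p t ⋆ K) x • v t x with h𝒞
  set IT : ℝ := ∫ z, ωK z.1 z.2 * Torus.timeDeriv ψ₁ z.1 z.2 ∂μT with hIT
  set IX : ℝ := ∫ z, ωK z.1 z.2 * ⟪v z.1 z.2, Torus.gradient (ψ₁ z.1) z.2⟫ ∂μT with hIX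
  set IC : ℝ := ∫ z, ⟪CK z.1 z.2, Torus.gradient (ψ₁ z.1) z.2⟫ ∂μT with hIC
  have hX : D ψ₁ + D (fun t => ψ₁ t ⋆ K) = 2⁻¹ * ID + 2⁻¹ * IT + 2⁻¹ * IX + IC := by
    rw [hDE ψ₁ hψ₁T, hDE _ hψ₁εT]
    have h2 : 2 * (energyFluxFunctional T v p ψ₁ + energyFluxFunctional T v p (fun t => ψ₁ t ⋆ K)) =
        ID + IT + IX + 2 * IC := hid
    linear_combination (2⁻¹ : ℝ) * h2
  ---------------------------------------------------------------------------------------------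
  -- Step 2: the cut-off test function `ψ₁`: bounds and support
  ---------------------------------------------------------------------------------------------
  set A : Set (ℝ × UnitAddTorus d) := thickening (4 * δ) Z with hA
  have hAm : MeasurableSet A := isOpen_thickening.measurableSet
  have hχball : ∀ z, z ∉ A → ∀ w ∈ ball z δ, χ w.1 w.2 = 0 := by
    intro z hz w hw
    refine hχ0 w fun hw3 => hz ?_
    have h1 : z ∈ ball w δ := by rw [mem_ball, dist_comm]; exact mem_ball.1 hw
    have h2 := ball_subset_thickening_of_mem_thickening (δ := δ) hw3 h1
    rwa [show δ + 3 * δ = 4 * δ by ring] at h2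
  have hχA : ∀ z, z ∉ A → χ z.1 z.2 = 0 := fun z hz => hχball z hz z (mem_ball_self hδ)
  have hdtψ₁ : ∀ t x, Torus.timeDeriv ψ₁ t x = Torus.timeDeriv φ t x * χ t x + φ t x * Torus.timeDeriv χ t x :=
    fun t x => timeDeriv_mul_of_contDiff hφ.1.1 hχs t x
  have hgrψ₁ : ∀ t x, Torus.gradient (ψ₁ t) x = χ t x • Torus.gradient (φ t) x + φ t x • Torus.gradient (χ t) x :=
    fun t x => gradient_mul_of_isSmooth (isSmooth_slice_of_contDiff_stLift hφ.1.1 t) (isSmooth_slice_of_contDiff_stLift hχs t) x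
  -- pointwise bounds on `[0,T]`
  have hb1δ : C1 + C0 * (Ccut / δ) ≤ b1 / δ ∧ C2 + C0 * (Ccut / δ) ≤ b1 / δ := by
    constructor
    · rw [le_div_iff₀ hδ, add_mul, mul_assoc, div_mul_cancel₀ _ hδ.ne', hb1]
      nlinarith [mul_le_of_le_one_right hC10 hδ1, mul_nonneg hC00 hCcut0]
    · rw [le_div_iff₀ hδ, add_mul, mul_assoc, div_mul_cancel₀ _ hδ.ne', hb1]
      nlinarith [mul_le_of_le_one_right hC20 hδ1, mul_nonneg hC00 hCcut0]
  have hψ₁b : ∀ t ∈ Icc 0 T, ∀ x, |ψ₁ t x| ≤ C0 := by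
    intro t ht x
    simp only [hψ₁, abs_mul]
    calc |φ t x| * |χ t x| ≤ C0 * 1 := by
          gcongr
          · exact (Real.norm_eq_abs _).symm.le.trans (hC0 t ht x)
          · rw [abs_of_nonneg (hχ01 t x).1]; exact (hχ01 t x).2
      _ = C0 := mul_one _
  have hdtψ₁b : ∀ t ∈ Icc 0 T, ∀ x, |Torus.timeDeriv ψ₁ t x| ≤ b1 / δ := by
    intro t ht x
    rw [hdtψ₁]
    calc |Torus.timeDeriv φ t x * χ t x + φ t x * Torus.timeDeriv χ t x|
        ≤ |Torus.timeDeriv φ t x| * |χ t x| + |φ t x| * |Torus.timeDeriv χ t x| := by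
          refine (abs_add_le _ _).trans ?_; rw [abs_mul, abs_mul]
      _ ≤ C1 * 1 + C0 * (Ccut / δ) := by
          gcongr
          · exact (Real.norm_eq_abs _).symm.le.trans (hC1 t ht x)
          · rw [abs_of_nonneg (hχ01 t x).1]; exact (hχ01 t x).2
          · exact (Real.norm_eq_abs _).symm.le.trans (hC0 t ht x)
          · exact hχt t x
      _ ≤ b1 / δ := by rw [mul_one]; exact hb1δ.1
  have hgrψ₁b : ∀ t ∈ Icc 0 T, ∀ x, ‖Torus.gradient (ψ₁ t) x‖ ≤ b1 / δ := by
    intro t ht x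
    rw [hgrψ₁]
    calc ‖χ t x • Torus.gradient (φ t) x + φ t x • Torus.gradient (χ t) x‖
        ≤ |χ t x| * ‖Torus.gradient (φ t) x‖ + |φ t x| * ‖Torus.gradient (χ t) x‖ := by
          refine (norm_add_le _ _).trans ?_; rw [norm_smul, norm_smul, Real.norm_eq_abs, Real.norm_eq_abs]
      _ ≤ 1 * C2 + C0 * (Ccut / δ) := by
          gcongr
          · rw [abs_of_nonneg (hχ01 t x).1]; exact (hχ01 t x).2
          · exact hC2 t ht x
          · exact (Real.norm_eq_abs _).symm.le.trans (hC0 t ht x)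
          · exact hχx t x
      _ ≤ b1 / δ := by rw [one_mul]; exact hb1δ.2
  -- vanishing off `A`
  have hψ₁A : ∀ z, z ∉ A → ψ₁ z.1 z.2 = 0 := fun z hz => by simp only [hψ₁, hχA z hz, mul_zero]
  have hdtψ₁A : ∀ z, z ∉ A → Torus.timeDeriv ψ₁ z.1 z.2 = 0 := fun z hz => by
    rw [hdtψ₁, hχA z hz, timeDeriv_eq_zero_of_ball hδ (hχball z hz), mul_zero, mul_zero, add_zero]
  have hgrψ₁A : ∀ z, z ∉ A → Torus.gradient (ψ₁ z.1) z.2 = 0 := fun z hz => by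
    rw [hgrψ₁, hχA z hz, gradient_eq_zero_of_ball hδ (hχball z hz), zero_smul, smul_zero, add_zero]
  -- a.e. time in `(0,T)`
  have hIoo : ∀ᵐ z ∂μT, z.1 ∈ Ioo 0 T := ae_fst_mem_Ioo T
  ---------------------------------------------------------------------------------------------
  -- Step 3: the measure of `A` (kept explicit) and the exponent algebra
  ---------------------------------------------------------------------------------------------
  have hμAt : μT A ≠ ⊤ := measure_ne_top μT A
  set VA : ℝ := (μT A ^ (1 - 1 / (q / 3).toReal)).toReal with hVA
  have hVA0 : 0 ≤ VA := ENNReal.toReal_nonneg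
  -- powers of `ε` and `δ`
  have hε3 : ε⁻¹ * (ε ^ θ) ^ 3 = ε ^ (3 * θ - 1) := by
    rw [show ((ε ^ θ) ^ 3 : ℝ) = ε ^ (3 * θ) by
      rw [← Real.rpow_natCast, ← Real.rpow_mul hε.le]; ring_nf,
      Real.rpow_sub_one hε.ne', div_eq_inv_mul]
  have hε2 : ((ε ^ θ) ^ 2 : ℝ) = ε ^ (2 * θ) := by
    rw [← Real.rpow_natCast, ← Real.rpow_mul hε.le]; ring_nf
  have hE3 : 0 ≤ ε ^ (3 * θ - 1) := Real.rpow_nonneg hε.le _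
  have hE2 : 0 ≤ ε ^ (2 * θ) := Real.rpow_nonneg hε.le _
  -- `toReal` of the `ℝ≥0∞` constants
  have htoD : (ENNReal.ofReal (ε⁻¹ * C₁) * ENNReal.ofReal (ε ^ θ) ^ 3 * N ^ (3 : ℕ)).toReal =
      ε⁻¹ * C₁ * (ε ^ θ) ^ 3 * NR ^ 3 := by
    rw [ENNReal.toReal_mul, ENNReal.toReal_mul, ENNReal.toReal_pow, ENNReal.toReal_pow,
      ENNReal.toReal_ofReal (by positivity), ENNReal.toReal_ofReal (by positivity)]
  have htoT : (ENNReal.ofReal (ε ^ θ) ^ 2 * (N ^ q.toReal + ENNReal.ofReal T) ^ (1 / (q / 3).toReal)).toReal =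
      (ε ^ θ) ^ 2 * KT := by
    rw [ENNReal.toReal_mul, ENNReal.toReal_pow, ENNReal.toReal_ofReal (by positivity)]
  have htoX : (ENNReal.ofReal (ε ^ θ) ^ 2 * N ^ (3 : ℕ)).toReal = (ε ^ θ) ^ 2 * NR ^ 3 := by
    rw [ENNReal.toReal_mul, ENNReal.toReal_pow, ENNReal.toReal_pow, ENNReal.toReal_ofReal (by positivity)]
  have htoC : (Cq * ENNReal.ofReal (ε ^ θ) ^ 2 * N ^ (3 : ℕ)).toReal = CqR * (ε ^ θ) ^ 2 * NR ^ 3 := by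
    rw [ENNReal.toReal_mul, ENNReal.toReal_mul, ENNReal.toReal_pow, ENNReal.toReal_pow,
      ENNReal.toReal_ofReal (by positivity)]
  have hfinT : (N ^ q.toReal + ENNReal.ofReal T) ^ (1 / (q / 3).toReal) ≠ ⊤ :=
    ENNReal.rpow_ne_top_of_nonneg (by positivity)
      (ENNReal.add_ne_top.2 ⟨ENNReal.rpow_ne_top_of_nonneg hqq.le hNt, ENNReal.ofReal_ne_top⟩)
  have hN3t : N ^ (3 : ℕ) ≠ ⊤ := ENNReal.pow_ne_top hNt
  ---------------------------------------------------------------------------------------------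
  -- Step 4: the four bounds
  ---------------------------------------------------------------------------------------------
  -- measurability of the three fields
  have hDm : AEStronglyMeasurable (uncurry fun t x => kernelFlux K (v t) x) μT := by
    have hδ' : AEStronglyMeasurable (fun w : (ℝ × UnitAddTorus d) × UnitAddTorus d =>
        v w.1.1 (w.1.2 + w.2) - v w.1.1 w.1.2) (μT.prod volume) :=
      (aestronglyMeasurable_translate (ν := volume) hum measurable_id).sub hum.comp_fst
    have hΨ : AEStronglyMeasurable (fun w : (ℝ × UnitAddTorus d) × UnitAddTorus d =>
        ⟪Torus.gradient K w.2, v w.1.1 (w.1.2 + w.2) - v w.1.1 w.1.2⟫ *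
          ‖v w.1.1 (w.1.2 + w.2) - v w.1.1 w.1.2‖ ^ 2) (μT.prod volume) :=
      ((hK.gradient.continuous.aestronglyMeasurable.comp_snd).inner hδ').mul (hδ'.norm.pow 2)
    exact hΨ.integral_prod_right'
  have hωm : AEStronglyMeasurable (uncurry ωK) μT := aestronglyMeasurable_uncurry_quadIncrement hK.continuous hum
  have h𝒞m : AEStronglyMeasurable (uncurry CK) μT :=
    aestronglyMeasurable_uncurry_pressureRemainder hK.continuous hum hpm
  have hωvm : AEStronglyMeasurable (uncurry fun t x => ωK t x * ‖v t x‖) μT := hωm.mul hum.norm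
  -- (D) the flux term
  have hTD : |ID| ≤ cD * ε ^ (3 * θ - 1) * VA := by
    have hB := eLpNorm_uncurry_kernelFlux_le (ε := ε) hum hq hq' hθ.1 hv hε hε'
    have h := abs_integral_le_of_eLpNorm_le (μ := μT) (f := fun z => kernelFlux K (v z.1) z.2 * ψ₁ z.1 z.2)
      (F := uncurry fun t x => kernelFlux K (v t) x) (g := fun z => |ψ₁ z.1 z.2|) hDm hAm hC00
      (ae_of_all _ fun z => by simp only [uncurry, Real.norm_eq_abs, abs_mul]; rfl)
      (hIoo.mono fun z hz _ => hψ₁b z.1 (Ioo_subset_Icc_self hz) z.2)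
      (fun z hz => by simp only [hψ₁A z hz, abs_zero]) hr1 hB
      (ENNReal.mul_ne_top (ENNReal.mul_ne_top ENNReal.ofReal_ne_top (ENNReal.pow_ne_top ENNReal.ofReal_ne_top)) hN3t)
      hμAt
    rw [htoD] at h
    refine h.trans (le_of_eq ?_)
    calc C0 * (ε⁻¹ * C₁ * (ε ^ θ) ^ 3 * NR ^ 3 * VA)
        = cD * (ε⁻¹ * (ε ^ θ) ^ 3) * VA := by rw [hcD]; ring
      _ = cD * ε ^ (3 * θ - 1) * VA := by rw [hε3]
  -- (T) the quadratic commutator against `∂ₜψ₁`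
  have hTT : |IT| ≤ cT * (ε ^ (2 * θ) / δ) * VA := by
    have hB := eLpNorm_uncurry_quadIncrement_le (ε := ε) hum hq hq' hθ.1 hv hε hε'
    have h := abs_integral_le_of_eLpNorm_le (μ := μT) (f := fun z => ωK z.1 z.2 * Torus.timeDeriv ψ₁ z.1 z.2)
      (F := uncurry ωK) (g := fun z => |Torus.timeDeriv ψ₁ z.1 z.2|) hωm hAm (div_nonneg hb10 hδ.le)
      (ae_of_all _ fun z => by simp only [uncurry, Real.norm_eq_abs, abs_mul]; rfl)
      (hIoo.mono fun z hz _ => hdtψ₁b z.1 (Ioo_subset_Icc_self hz) z.2)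
      (fun z hz => by simp only [hdtψ₁A z hz, abs_zero]) hr1 hB
      (ENNReal.mul_ne_top (ENNReal.pow_ne_top ENNReal.ofReal_ne_top) hfinT) hμAt
    rw [htoT] at h
    refine h.trans (le_of_eq ?_)
    calc b1 / δ * ((ε ^ θ) ^ 2 * KT * VA)
        = cT * ((ε ^ θ) ^ 2 / δ) * VA := by rw [hcT]; ring
      _ = cT * (ε ^ (2 * θ) / δ) * VA := by rw [hε2]
  -- (X) the quadratic commutator against `⟪v, ∇ψ₁⟫`
  have hTX : |IX| ≤ cX * (ε ^ (2 * θ) / δ) * VA := by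
    have hB := eLpNorm_uncurry_quadIncrement_mul_norm_le (ε := ε) hum hq hq' hθ.1 hv hε hε'
    have h := abs_integral_le_of_eLpNorm_le (μ := μT)
      (f := fun z => ωK z.1 z.2 * ⟪v z.1 z.2, Torus.gradient (ψ₁ z.1) z.2⟫)
      (F := uncurry fun t x => ωK t x * ‖v t x‖) (g := fun z => ‖Torus.gradient (ψ₁ z.1) z.2‖) hωvm hAm
      (div_nonneg hb10 hδ.le)
      (ae_of_all _ fun z => by
        simp only [uncurry, Real.norm_eq_abs, abs_mul, abs_norm]
        rw [mul_assoc]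
        gcongr
        exact abs_real_inner_le_norm _ _)
      (hIoo.mono fun z hz _ => hgrψ₁b z.1 (Ioo_subset_Icc_self hz) z.2)
      (fun z hz => by simp only [hgrψ₁A z hz, norm_zero]) hr1 hB
      (ENNReal.mul_ne_top (ENNReal.pow_ne_top ENNReal.ofReal_ne_top) hN3t) hμAt
    rw [htoX] at h
    refine h.trans (le_of_eq ?_)
    calc b1 / δ * ((ε ^ θ) ^ 2 * NR ^ 3 * VA)
        = cX * ((ε ^ θ) ^ 2 / δ) * VA := by rw [hcX]; ring
      _ = cX * (ε ^ (2 * θ) / δ) * VA := by rw [hε2]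
  -- (C) the pressure commutator
  have hTC : |IC| ≤ cC * (ε ^ (2 * θ) / δ) * VA := by
    have hB := eLpNorm_uncurry_pressureRemainder_le (ε := ε) hum hpm hq hq' hθ.1 hv hpi hCq hPθ hε hε'
    have h := abs_integral_le_of_eLpNorm_le (μ := μT)
      (f := fun z => ⟪CK z.1 z.2, Torus.gradient (ψ₁ z.1) z.2⟫)
      (F := uncurry CK) (g := fun z => ‖Torus.gradient (ψ₁ z.1) z.2‖) h𝒞m hAm (div_nonneg hb10 hδ.le)
      (ae_of_all _ fun z => by
        simp only [uncurry, Real.norm_eq_abs]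
        exact abs_real_inner_le_norm _ _)
      (hIoo.mono fun z hz _ => hgrψ₁b z.1 (Ioo_subset_Icc_self hz) z.2)
      (fun z hz => by simp only [hgrψ₁A z hz, norm_zero]) hr1 hB
      (ENNReal.mul_ne_top (ENNReal.mul_ne_top hCq (ENNReal.pow_ne_top ENNReal.ofReal_ne_top)) hN3t) hμAt
    rw [htoC] at h
    refine h.trans (le_of_eq ?_)
    calc b1 / δ * (CqR * (ε ^ θ) ^ 2 * NR ^ 3 * VA)
        = cC * ((ε ^ θ) ^ 2 / δ) * VA := by rw [hcC]; ring
      _ = cC * (ε ^ (2 * θ) / δ) * VA := by rw [hε2]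
  ---------------------------------------------------------------------------------------------
  -- Step 5: conclusion
  ---------------------------------------------------------------------------------------------
  show |D ψ₁ + D (fun t => ψ₁ t ⋆ K)| ≤ M * (ε ^ (3 * θ - 1) + ε ^ (2 * θ) / δ) * VA
  rw [hX]
  set P : ℝ := ε ^ (3 * θ - 1) with hPdef
  set Q : ℝ := ε ^ (2 * θ) / δ with hQdef
  have hP0 : 0 ≤ P := hE3
  have hQ0 : 0 ≤ Q := div_nonneg hE2 hδ.le
  have habs : |2⁻¹ * ID + 2⁻¹ * IT + 2⁻¹ * IX + IC| ≤ 2⁻¹ * |ID| + 2⁻¹ * |IT| + 2⁻¹ * |IX| + |IC| := by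
    have h2 : (0 : ℝ) ≤ 2⁻¹ := by norm_num
    calc |2⁻¹ * ID + 2⁻¹ * IT + 2⁻¹ * IX + IC|
        ≤ |2⁻¹ * ID| + |2⁻¹ * IT| + |2⁻¹ * IX| + |IC| := by
          refine (abs_add_le _ _).trans ?_
          gcongr
          refine (abs_add_le _ _).trans ?_
          gcongr
          exact abs_add_le _ _
      _ = 2⁻¹ * |ID| + 2⁻¹ * |IT| + 2⁻¹ * |IX| + |IC| := by
          rw [abs_mul, abs_mul, abs_mul, abs_of_nonneg h2]
  have h1 : 2⁻¹ * cD * (P * VA) ≤ M * (P * VA) :=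
    mul_le_mul_of_nonneg_right (by rw [hM]; linarith) (mul_nonneg hP0 hVA0)
  have h2 : (2⁻¹ * cT + 2⁻¹ * cX + cC) * (Q * VA) ≤ M * (Q * VA) :=
    mul_le_mul_of_nonneg_right (by rw [hM]; linarith) (mul_nonneg hQ0 hVA0)
  calc |2⁻¹ * ID + 2⁻¹ * IT + 2⁻¹ * IX + IC| ≤ 2⁻¹ * |ID| + 2⁻¹ * |IT| + 2⁻¹ * |IX| + |IC| := habs
    _ ≤ 2⁻¹ * (cD * P * VA) + 2⁻¹ * (cT * Q * VA) + 2⁻¹ * (cX * Q * VA) + cC * Q * VA := by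
        gcongr
    _ = 2⁻¹ * cD * (P * VA) + (2⁻¹ * cT + 2⁻¹ * cX + cC) * (Q * VA) := by ring
    _ ≤ M * (P * VA) + M * (Q * VA) := add_le_add h1 h2
    _ = M * (P + Q) * VA := by ring

end Flux

section Core

open Literature.Analysis.FunctionSpaces Literature.Analysis.FunctionSpaces.Torus
open Literature.Analysis.FluidPDE Literature.Analysis.FluidPDE.Torus

variable {d : Type} [Fintype d]

/-- Slice-wise mollification by a non-negative kernel preserves non-negativity. [folklore] -/
theorem conv_kernel_nonneg {ψ : UnitAddTorus d → ℝ} (hψ : ∀ x, 0 ≤ ψ x) {ε : ℝ} (hε : 0 ≤ ε)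
    (x : UnitAddTorus d) : 0 ≤ (ψ ⋆ Torus.kernel ε) x := by
  rw [convolution_lsmul]
  exact integral_nonneg fun y => smul_nonneg (hψ y) (Torus.kernel_nonneg hε _)

/-- **The core of Thm. 1.1(i) of De Rosa–Drivas–Inversi–Isett (2025) for a non-negative
Duchon–Robert measure, from the localized symmetric flux bound.** Let `μ` be a finite measure on
`ℝ × T^d`, `φ` a continuous function with values in `[0,1]` equal to `1` on `[a', b'] × T^d`, and
suppose the localized flux bound holds for `ψ ↦ ∫ ψ dμ`: for all `Z`, `ρ ∈ (0,1]`, `ε ∈ (0,1/4]`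
there is a cut-off `χ` of `Z` at scale `ρ` with
`|∫ φχ dμ + ∫ (φχ) ⋆ₓ k_ε dμ| ≤ M (ε^{3θ-1} + ε^{2θ}/ρ) |(Z)_{4ρ} ∩ ((0,T) × T^d)|^{1-3/q}`.
If `0 ≤ s` and `1 - (1 - 3/q)(d + 1 - s) < 2θ/(1-θ)`, then every `A ⊆ [a, b] × T^d` with
`[a - ρ₀, b + ρ₀] ⊆ [a', b']` (`0 < ρ₀ ≤ 1/4`) and `H^s(A) = 0` is `μ`-null: with
`ε = ρ^{1/(1-θ)}` and `|B_ρ| ≤ (2ρ)^{d+1}` the flux bound gives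
`μ(⋃_{z ∈ Z} B(z,ρ)) ≤ 2M 8^{(d+1)(1-3/q)} (#Z)^{1-3/q} ρ^{(d+1)(1-3/q) + 2θ/(1-θ) - 1}` for finite
`Z ⊆ A` (the mass of the balls is at most `∫ φχ dμ ≤ ∫ φχ dμ + ∫ (φχ) ⋆ₓ k_ε dμ`, both
integrands being non-negative), and the covering lemma
`measure_eq_zero_of_hausdorffMeasure_eq_zero` applies with
`λ = (d+1)(1-3/q) + 2θ/(1-θ) - 1 > s(1-3/q)`. [cite: DeRosaDrivasInversiIsett2025, Thm. 1.1(i) and §3 Step 2] -/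
theorem measure_eq_zero_of_localizedFluxBound {T : ℝ}
    (μ : Measure (ℝ × UnitAddTorus d)) [IsFiniteMeasure μ]
    {q : ℝ≥0∞} (hq : 3 ≤ q) (hq' : q ≠ ⊤) {θ : ℝ} (hθ : 0 < θ ∧ θ < 1)
    {φ : ℝ → UnitAddTorus d → ℝ} (hφc : Continuous (uncurry φ))
    (hφ01 : ∀ t x, 0 ≤ φ t x ∧ φ t x ≤ 1)
    {a' b' : ℝ} (hφ1 : ∀ t ∈ Icc a' b', ∀ x, φ t x = 1)
    {M : ℝ} (hM : 0 ≤ M)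
    (hflux : ∀ (Z : Set (ℝ × UnitAddTorus d)) (ρ ε : ℝ), 0 < ε → ε ≤ 1 / 4 → 0 < ρ → ρ ≤ 1 →
      ∃ χ : ℝ → UnitAddTorus d → ℝ, ContDiff ℝ ∞ (stLift χ) ∧ (∀ t x, 0 ≤ χ t x ∧ χ t x ≤ 1) ∧
        (∀ z ∈ thickening ρ Z, χ z.1 z.2 = 1) ∧
        |STFunctional.ofMeasure μ (fun t x => φ t x * χ t x) +
            STFunctional.ofMeasure μ (fun t => (fun x => φ t x * χ t x) ⋆ Torus.kernel ε)| ≤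
          M * (ε ^ (3 * θ - 1) + ε ^ (2 * θ) / ρ) *
            ((((volume.restrict (Ioo 0 T)).prod volume) (thickening (4 * ρ) Z)) ^
              (1 - 1 / (q / 3).toReal)).toReal)
    {s : ℝ} (hs : 0 ≤ s)
    (hcond : 1 - (1 - 3 / q).toReal * ((Fintype.card d : ℝ) + 1 - s) < 2 * θ / (1 - θ))
    {a b ρ₀ : ℝ} (hρ₀ : 0 < ρ₀) (hρ₀' : ρ₀ ≤ 1 / 4) (haa : a' ≤ a - ρ₀) (hbb : b + ρ₀ ≤ b')
    {A : Set (ℝ × UnitAddTorus d)} (hA : A ⊆ Icc a b ×ˢ univ) (hH : μH[s] A = 0) : μ A = 0 := by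
  set n : ℝ := (Fintype.card d : ℝ) with hn
  set μT := (volume.restrict (Ioo 0 T)).prod (volume : Measure (UnitAddTorus d)) with hμT
  have hμTeq : μT = volume.restrict (Ioo 0 T ×ˢ (univ : Set (UnitAddTorus d))) := by
    rw [hμT, Measure.volume_eq_prod, ← Measure.prod_restrict, Measure.restrict_univ]
  -- exponents
  have hq0 : q ≠ 0 := (lt_of_lt_of_le (by norm_num) hq).ne'
  have hqq : 0 < q.toReal := ENNReal.toReal_pos hq0 hq'
  have hq3r : 3 ≤ q.toReal := by
    have := (ENNReal.toReal_le_toReal (by norm_num) hq').2 hq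
    simpa using this
  have hr3 : (q / 3).toReal = q.toReal / 3 := by rw [ENNReal.toReal_div]; norm_num
  set e : ℝ := (1 - 3 / q).toReal with he
  have he' : e = 1 - 3 / q.toReal := by
    rw [he, ENNReal.toReal_sub_of_le ?_ ENNReal.one_ne_top, ENNReal.toReal_one, ENNReal.toReal_div,
      ENNReal.toReal_ofNat]
    rw [ENNReal.div_le_iff hq0 hq', one_mul]
    exact hq
  have hee : 1 - 1 / (q / 3).toReal = e := by
    rw [he', hr3]; field_simp
  have he0 : 0 ≤ e := by
    rw [he']
    have : 3 / q.toReal ≤ 1 := by rw [div_le_one hqq]; exact hq3r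
    linarith
  have h1θ : 0 < 1 - θ := by linarith [hθ.2]
  set τ₀ : ℝ := 2 * θ / (1 - θ) - 1 with hτ₀
  set lam : ℝ := (n + 1) * e + τ₀ with hlam
  have hlam' : s * e < lam := by
    rw [hlam, hτ₀]
    have h' : 1 - e * (n + 1 - s) < 2 * θ / (1 - θ) := hcond
    nlinarith
  -- the constant
  set M' : ℝ := 2 * M * (8 : ℝ) ^ ((n + 1) * e) with hM'
  have hM'0 : 0 ≤ M' := by rw [hM']; positivity
  refine measure_eq_zero_of_hausdorffMeasure_eq_zero μ hs he0 hM'0 hρ₀ hlam' (fun k Z hZA => ?_) hH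
  -- the bound for a finite set of centres `Z ⊆ A` at scale `ρ = ρ₀ 2^{-k}`
  set ρ : ℝ := ρ₀ * 2⁻¹ ^ k with hρ
  have hρpos : 0 < ρ := mul_pos hρ₀ (pow_pos (by norm_num) k)
  have hρle : ρ ≤ ρ₀ := by
    rw [hρ]; exact mul_le_of_le_one_right hρ₀.le (pow_le_one₀ (by norm_num) (by norm_num))
  have hρ4 : ρ ≤ 1 / 4 := hρle.trans hρ₀'
  have hρ1 : ρ ≤ 1 := hρ4.trans (by norm_num)
  set ε : ℝ := ρ ^ (1 / (1 - θ)) with hεdef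
  have hε : 0 < ε := Real.rpow_pos_of_pos hρpos _
  have hexp1 : 1 ≤ 1 / (1 - θ) := by rw [le_div_iff₀ h1θ]; linarith [hθ.1]
  have hε' : ε ≤ 1 / 4 := by
    calc ε ≤ ρ ^ (1 : ℝ) := Real.rpow_le_rpow_of_exponent_ge hρpos hρ1 hexp1
      _ = ρ := Real.rpow_one ρ
      _ ≤ 1 / 4 := hρ4
  obtain ⟨χ, hχs, hχ01, hχ1, hbd⟩ := hflux (↑Z : Set (ℝ × UnitAddTorus d)) ρ ε hε hε' hρpos hρ1
  -- the localized test `ψ = φ χ`: `ψ = 1` on the balls, `0 ≤ ψ ≤ 1`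
  have hψ0 : ∀ t x, 0 ≤ φ t x * χ t x := fun t x => mul_nonneg (hφ01 t x).1 (hχ01 t x).1
  have hψle1 : ∀ t x, φ t x * χ t x ≤ 1 := fun t x => by
    calc φ t x * χ t x ≤ 1 * 1 := mul_le_mul (hφ01 t x).2 (hχ01 t x).2 (hχ01 t x).1 zero_le_one
      _ = 1 := one_mul _
  set U : Set (ℝ × UnitAddTorus d) := ⋃ z ∈ Z, ball z ρ with hU
  have hUm : MeasurableSet U := (isOpen_biUnion fun _ _ => isOpen_ball).measurableSet
  have hψU : ∀ w ∈ U, φ w.1 w.2 * χ w.1 w.2 = 1 := by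
    intro w hw
    obtain ⟨z, hz, hwz⟩ := mem_iUnion₂.1 hw
    have hzA : z ∈ A := hZA (Finset.mem_coe.2 hz)
    have hz1 : z.1 ∈ Icc a b := (hA hzA).1
    have hw1 : dist w.1 z.1 < ρ :=
      lt_of_le_of_lt (by rw [Prod.dist_eq]; exact le_max_left _ _) (mem_ball.1 hwz)
    have hwt : w.1 ∈ Icc a' b' := by
      rw [Real.dist_eq, abs_lt] at hw1
      exact ⟨by linarith [hz1.1], by linarith [hz1.2]⟩
    have hχw : χ w.1 w.2 = 1 := hχ1 w (ball_subset_thickening (Finset.mem_coe.2 hz) ρ hwz)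
    rw [hφ1 w.1 hwt w.2, hχw, mul_one]
  -- `μ U ≤ ∫ φχ dμ ≤ ∫ φχ dμ + ∫ (φχ) ⋆ k_ε dμ ≤ bound`
  have hψc : Continuous (uncurry fun t x => φ t x * χ t x) :=
    hφc.mul (continuous_uncurry_of_continuous_stLift hχs.continuous)
  have hψi : Integrable (fun w : ℝ × UnitAddTorus d => φ w.1 w.2 * χ w.1 w.2) μ := by
    refine (integrable_const (1 : ℝ)).mono' hψc.aestronglyMeasurable (ae_of_all _ fun w => ?_)
    rw [Real.norm_of_nonneg (hψ0 w.1 w.2)]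
    exact hψle1 w.1 w.2
  have hUle : (μ U).toReal ≤ ∫ w, φ w.1 w.2 * χ w.1 w.2 ∂μ := by
    have h1 : (μ U).toReal = ∫ w, U.indicator (1 : ℝ × UnitAddTorus d → ℝ) w ∂μ := by
      rw [integral_indicator_one hUm]; rfl
    rw [h1]
    refine integral_mono ((integrable_const (1 : ℝ)).indicator hUm) hψi fun w => ?_
    by_cases hw : w ∈ U
    · rw [indicator_of_mem hw, Pi.one_apply, hψU w hw]
    · rw [indicator_of_notMem hw]; exact hψ0 w.1 w.2
  have hconv0 : 0 ≤ STFunctional.ofMeasure μ (fun t => (fun x => φ t x * χ t x) ⋆ Torus.kernel ε) :=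
    integral_nonneg fun w => conv_kernel_nonneg (hψ0 w.1) hε.le w.2
  set VA : ℝ := ((μT (thickening (4 * ρ) (↑Z : Set (ℝ × UnitAddTorus d)))) ^
    (1 - 1 / (q / 3).toReal)).toReal with hVA
  have hVA0 : 0 ≤ VA := ENNReal.toReal_nonneg
  have hUbd : (μ U).toReal ≤ M * (ε ^ (3 * θ - 1) + ε ^ (2 * θ) / ρ) * VA := by
    calc (μ U).toReal ≤ STFunctional.ofMeasure μ (fun t x => φ t x * χ t x) := hUle
      _ ≤ STFunctional.ofMeasure μ (fun t x => φ t x * χ t x) +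
            STFunctional.ofMeasure μ (fun t => (fun x => φ t x * χ t x) ⋆ Torus.kernel ε) :=
          le_add_of_nonneg_right hconv0
      _ ≤ |STFunctional.ofMeasure μ (fun t x => φ t x * χ t x) +
            STFunctional.ofMeasure μ (fun t => (fun x => φ t x * χ t x) ⋆ Torus.kernel ε)| :=
          le_abs_self _
      _ ≤ M * (ε ^ (3 * θ - 1) + ε ^ (2 * θ) / ρ) * VA := hbd
  ---------------------------------------------------------------------------------------------
  -- the exponent algebra: `ε^{3θ-1} + ε^{2θ}/ρ = 2ρ^{τ₀}`, `VA ≤ (#Z)^e (8ρ)^{(n+1)e}`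
  ---------------------------------------------------------------------------------------------
  have hετ : ε ^ (3 * θ - 1) + ε ^ (2 * θ) / ρ = 2 * ρ ^ τ₀ := by
    have e1 : ε ^ (3 * θ - 1) = ρ ^ τ₀ := by
      rw [hεdef, ← Real.rpow_mul hρpos.le]
      congr 1
      rw [hτ₀]; field_simp; ring
    have e2 : ε ^ (2 * θ) / ρ = ρ ^ τ₀ := by
      rw [hεdef, ← Real.rpow_mul hρpos.le, hτ₀, Real.rpow_sub_one hρpos.ne']
      congr 2
      field_simp
    rw [e1, e2]; ring
  have hvol : μT (thickening (4 * ρ) (↑Z : Set (ℝ × UnitAddTorus d))) ≤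
      ENNReal.ofReal ((Z.card : ℝ) * (8 * ρ) ^ (Fintype.card d + 1)) := by
    have h1 : μT (thickening (4 * ρ) (↑Z : Set (ℝ × UnitAddTorus d))) ≤
        volume (thickening (4 * ρ) (↑Z : Set (ℝ × UnitAddTorus d))) := by
      rw [hμTeq]; exact Measure.le_iff'.1 Measure.restrict_le_self _
    refine h1.trans ?_
    rw [thickening_eq_biUnion_ball]
    have h2 := volume_biUnion_ball_le Z (r := 4 * ρ) (by positivity)
    have h3 : (2 * (4 * ρ)) = 8 * ρ := by ring
    rw [h3] at h2
    exact h2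
  have hVAle : VA ≤ (Z.card : ℝ) ^ e * ((8 : ℝ) ^ ((n + 1) * e) * ρ ^ ((n + 1) * e)) := by
    have hW0 : 0 ≤ (Z.card : ℝ) * (8 * ρ) ^ (Fintype.card d + 1) := by positivity
    have h1 : μT (thickening (4 * ρ) (↑Z : Set (ℝ × UnitAddTorus d))) ^ e ≤
        ENNReal.ofReal (((Z.card : ℝ) * (8 * ρ) ^ (Fintype.card d + 1)) ^ e) := by
      rw [← ENNReal.ofReal_rpow_of_nonneg hW0 he0]
      exact ENNReal.rpow_le_rpow hvol he0
    have h2 : VA ≤ ((Z.card : ℝ) * (8 * ρ) ^ (Fintype.card d + 1)) ^ e := by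
      rw [hVA, hee]
      have := ENNReal.toReal_mono ENNReal.ofReal_ne_top h1
      rwa [ENNReal.toReal_ofReal (Real.rpow_nonneg hW0 _)] at this
    refine h2.trans (le_of_eq ?_)
    rw [Real.mul_rpow (Nat.cast_nonneg _) (by positivity), ← Real.rpow_natCast,
      ← Real.rpow_mul (by positivity), Nat.cast_add, Nat.cast_one, ← hn,
      Real.mul_rpow (by norm_num) hρpos.le]
  ---------------------------------------------------------------------------------------------
  -- conclusion
  ---------------------------------------------------------------------------------------------
  have hfin : (μ U).toReal ≤ M' * (Z.card : ℝ) ^ e * ρ ^ lam := by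
    calc (μ U).toReal ≤ M * (ε ^ (3 * θ - 1) + ε ^ (2 * θ) / ρ) * VA := hUbd
      _ = M * (2 * ρ ^ τ₀) * VA := by rw [hετ]
      _ ≤ M * (2 * ρ ^ τ₀) * ((Z.card : ℝ) ^ e * ((8 : ℝ) ^ ((n + 1) * e) * ρ ^ ((n + 1) * e))) := by
          gcongr
      _ = M' * (Z.card : ℝ) ^ e * (ρ ^ ((n + 1) * e) * ρ ^ τ₀) := by rw [hM']; ring
      _ = M' * (Z.card : ℝ) ^ e * ρ ^ lam := by rw [← Real.rpow_add hρpos]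
  calc μ U = ENNReal.ofReal ((μ U).toReal) := (ENNReal.ofReal_toReal (measure_ne_top μ U)).symm
    _ ≤ ENNReal.ofReal (M' * (Z.card : ℝ) ^ e * ρ ^ lam) := ENNReal.ofReal_le_ofReal hfin

end Core

end DeRosaDrivasInversiIsett2025

/-! ## Assembly: Cor. 5.1 -/

section Assembly

open Literature.Analysis Literature.Analysis.FunctionSpaces Literature.Analysis.FunctionSpaces.Torus
open Literature.Analysis.FluidPDE Literature.Analysis.FluidPDE.Torus

/-- **Cor. 5.1 for finite exponents `p ∈ [3,∞)`** (the printed contradiction argument of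
De Rosa–Drivas–Inversi–Isett 2025, §5.1, with De Rosa–Isett 2024, §6.1): a family bounded by `M`
in `L^q_t B^σ_{q,∞}` has, by `DeRosaIsett2024_s61_compactness_holds`, a subsequence converging in
`L³_{t,x}` to `v ∈ L^q_t B^σ_{q,∞}` (`DeRosaIsett2024.memLpBesovSup_of_tendsto_L3`) whose
Duchon–Robert functional, for the Calderón–Zygmund pressure, is `ψ ↦ ∫ ψ dD`
(`DeRosaIsett2024.hasLocalEnergyBalance_of_inviscidLimit`); the interior zeroth law makes `D`
charge a compact sub-slab `[ε₀, T'] × T^d` (`DeRosaIsett2024.exists_test_ofMeasure_pos`), hence —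
`D` giving no mass to the slab off `S` — the `H^s`-null set `([ε₀, T'] × T^d) ∩ S`, which
`DeRosaDrivasInversiIsett2025.measure_eq_zero_of_localizedFluxBound` (Thm. 1.1(i) for `D ≥ 0`,
fed with `DeRosaDrivasInversiIsett2025.localizedFluxBound` for the time cut-off
`DeRosaIsett2024.exists_timeCutoff`) declares `D`-null. [cite: DeRosaDrivasInversiIsett2025, Cor. 5.1, Thm. 1.1(i) and §5.1] -/
theorem DeRosaDrivasInversiIsett2025_cor51_finite
    {d : Type} [Fintype d] [DecidableEq d] (hd : 2 ≤ Fintype.card d) {T : ℝ} (hT : 0 < T)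
    {ν : ℕ → ℝ} (hν : ∀ j, 0 < ν j) (hν₀ : Tendsto ν atTop (𝓝 0))
    {u : ℕ → ℝ → UnitAddTorus d → EuclideanSpace ℝ d} {p : ℕ → ℝ → UnitAddTorus d → ℝ}
    (hNS : ∀ j, IsClassicalNSSolutionOn (Ioo 0 T) (ν j) 0 (u j) (p j))
    (hzeroth : ∃ δ : ℝ, 0 < δ ∧
      0 < liminf (fun j => ENNReal.ofReal (cumulativeDissipation (ν j) (u j) δ (T - δ))) atTop)
    {D : Measure (ℝ × UnitAddTorus d)} (hD : IsDissipationMeasureOf ν u T D)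
    {S : Set (ℝ × UnitAddTorus d)} (hconc : D ((Ioo 0 T ×ˢ univ) \ S) = 0)
    {s : ℝ} (hs : 0 ≤ s) (hH : μH[s] S = 0)
    {q : ℝ≥0∞} (hq : 3 ≤ q) (hq' : q ≠ ⊤) {σ : ℝ} (hσ : 0 < σ ∧ σ < 1)
    (hcond : 1 - (1 - 3 / q).toReal * ((Fintype.card d : ℝ) + 1 - s) < 2 * σ / (1 - σ))
    {M : ℝ≥0} (hM : ∀ j, eLpBesovSupNorm q σ q (u j) volume (Ioo 0 T) ≤ M) : False := by
  obtain ⟨_, -, -, -, hDfin, -⟩ := id hD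
  haveI : IsFiniteMeasure D := hDfin
  ---------------------------------------------------------------------------------------------
  -- (1) the limiting dissipation charges a compact sub-slab `K = [ε₀, T'] × T^d`, hence `K ∩ S`
  ---------------------------------------------------------------------------------------------
  obtain ⟨ψ₀, hψ₀, hpos⟩ := DeRosaIsett2024.exists_test_ofMeasure_pos hν hNS hzeroth hD
  obtain ⟨⟨-, T', hT'T, hT'⟩, ε₀, hε₀, hε₀'⟩ := id hψ₀
  obtain ⟨Cψ, hCψ⟩ := hψ₀.exists_abs_le
  set K : Set (ℝ × UnitAddTorus d) := Icc ε₀ T' ×ˢ univ with hK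
  have hKm : MeasurableSet K := measurableSet_Icc.prod MeasurableSet.univ
  have hψ₀K : ∀ z : ℝ × UnitAddTorus d, z ∉ K → ψ₀ z.1 z.2 = 0 := by
    intro z hz
    by_cases h1 : z.1 ≤ ε₀
    · exact congrFun (hε₀' z.1 h1) z.2
    · have h2 : T' ≤ z.1 := by
        by_contra h2
        exact hz ⟨⟨(not_le.1 h1).le, (not_le.1 h2).le⟩, mem_univ _⟩
      exact congrFun (hT' z.1 h2) z.2
  have hψ₀i : Integrable (fun z : ℝ × UnitAddTorus d => ψ₀ z.1 z.2) D :=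
    (integrable_const Cψ).mono' hψ₀.continuous_uncurry.aestronglyMeasurable
      (ae_of_all _ fun z => by rw [Real.norm_eq_abs]; exact hCψ z.1 z.2)
  have hDK : 0 < D K := by
    by_contra hzero
    have hK0 : D K = 0 := le_antisymm (not_lt.1 hzero) bot_le
    have hint : STFunctional.ofMeasure D ψ₀ ≤ (D K).toReal * Cψ := by
      have h1 : ∀ z : ℝ × UnitAddTorus d, ψ₀ z.1 z.2 ≤ K.indicator (fun _ => Cψ) z := by
        intro z
        by_cases hz : z ∈ K
        · rw [indicator_of_mem hz]; exact (le_abs_self _).trans (hCψ z.1 z.2)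
        · rw [indicator_of_notMem hz, hψ₀K z hz]
      calc STFunctional.ofMeasure D ψ₀ = ∫ z, ψ₀ z.1 z.2 ∂D := rfl
        _ ≤ ∫ z, K.indicator (fun _ => Cψ) z ∂D :=
            integral_mono hψ₀i ((integrable_const Cψ).indicator hKm) h1
        _ = (D K).toReal * Cψ := by rw [integral_indicator_const _ hKm, smul_eq_mul]; rfl
    rw [hK0, ENNReal.toReal_zero, zero_mul] at hint
    exact absurd hint (not_le.2 hpos)
  have hKsub : K ⊆ Ioo 0 T ×ˢ univ := fun z hz =>
    ⟨⟨hε₀.trans_le hz.1.1, hz.1.2.trans_lt hT'T⟩, mem_univ _⟩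
  have hDKS : 0 < D (K ∩ S) := by
    have h1 : D (K \ S) = 0 :=
      measure_mono_null (show K \ S ⊆ (Ioo 0 T ×ˢ univ) \ S from fun z hz => ⟨hKsub hz.1, hz.2⟩) hconc
    have h2 : D K ≤ D (K ∩ S) + D (K \ S) := by
      calc D K = D (K ∩ S ∪ K \ S) := by rw [inter_union_sdiff]
        _ ≤ D (K ∩ S) + D (K \ S) := measure_union_le _ _
    rw [h1, add_zero] at h2
    exact hDK.trans_le h2
  ---------------------------------------------------------------------------------------------
  -- (2) compactness, the Besov bound of the limit and the identification `D^v = D`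
  ---------------------------------------------------------------------------------------------
  obtain ⟨φ₂, v, hφ₂, hvm, hv3, hconv⟩ := DeRosaIsett2024_s61_compactness_holds d T hT ν hν hν₀ u p
    hNS q hq hq' σ hσ M hM
  have hwB : ∀ k, MemLpBesovSup q σ q (u (φ₂ k)) volume (Ioo 0 T) := fun k => by
    refine ⟨(ae_restrict_iff' measurableSet_Ioo).2 (ae_of_all _ fun t ht => ?_), ?_⟩
    · exact FunctionSpaces.Torus.IsSmooth.memBesovSup_holds
        ((hNS (φ₂ k)).smooth_velocity.isSmooth_slice ht) hσ.2.le q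
    · exact (hM (φ₂ k)).trans_lt ENNReal.coe_lt_top
  have hwm : ∀ k, AEStronglyMeasurable (stLift (u (φ₂ k))) (volume.restrict (Ioo 0 T ×ˢ univ)) :=
    fun k => (hNS (φ₂ k)).smooth_velocity.aestronglyMeasurable_stLift measurableSet_Ioo Subset.rfl
  obtain ⟨hvB, -⟩ := DeRosaIsett2024.memLpBesovSup_of_tendsto_L3 (le_trans (by norm_num) hq) hq' hwm
    hwB (fun k => hM (φ₂ k)) hvm hconv
  have hDφ : IsDissipationMeasureOf (fun k => ν (φ₂ k)) (fun k => u (φ₂ k)) T D :=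
    DeRosaDrivasInversiIsett2025.isDissipationMeasureOf_subseq hD hφ₂
  obtain ⟨P, hsol, hP32, hbal⟩ := DeRosaIsett2024.hasLocalEnergyBalance_of_inviscidLimit
    DeRosaIsett2024.exists_pressure_of_tendsto_L3_all (fun k => hν (φ₂ k))
    (hν₀.comp hφ₂.tendsto_atTop) (fun k => hNS (φ₂ k)) hDφ hvm hv3 hconv
  ---------------------------------------------------------------------------------------------
  -- (3) the time cut-off `φ = 1` on `[δ₁, T-δ₁] ⊇ [ε₀ - ρ₀, T' + ρ₀]` and the top scale `ρ₀`
  ---------------------------------------------------------------------------------------------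
  have hε₀T' : ε₀ < T' := by
    by_contra h
    have hzero : ∀ z : ℝ × UnitAddTorus d, ψ₀ z.1 z.2 = 0 := by
      intro z
      by_cases hz : z.1 ≤ ε₀
      · exact congrFun (hε₀' z.1 hz) z.2
      · exact congrFun (hT' z.1 (by linarith [not_le.1 hz, not_lt.1 h])) z.2
    have h0 : STFunctional.ofMeasure D ψ₀ = 0 := by
      show ∫ z, ψ₀ z.1 z.2 ∂D = 0
      simp [hzero]
    exact hpos.ne' h0
  set δ₁ : ℝ := min (ε₀ / 2) ((T - T') / 2) with hδ₁
  have hδ₁ε : δ₁ ≤ ε₀ / 2 := min_le_left _ _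
  have hδ₁T' : δ₁ ≤ (T - T') / 2 := min_le_right _ _
  have hδ₁pos : 0 < δ₁ := lt_min (by linarith) (by linarith)
  have hδ₁T : 2 * δ₁ < T := by linarith
  obtain ⟨η, hη, hηc, hη01, hη1, -⟩ := DeRosaIsett2024.exists_timeCutoff (d := d) hδ₁pos hδ₁T
  set ρ₀ : ℝ := min (1 / 4) δ₁ with hρ₀
  have hρ₀pos : 0 < ρ₀ := lt_min (by norm_num) hδ₁pos
  have hρ₀4 : ρ₀ ≤ 1 / 4 := min_le_left _ _
  have hρ₀δ : ρ₀ ≤ δ₁ := min_le_right _ _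
  have haa : δ₁ ≤ ε₀ - ρ₀ := by linarith
  have hbb : T' + ρ₀ ≤ T - δ₁ := by linarith
  ---------------------------------------------------------------------------------------------
  -- (4) Thm. 1.1(i): `D (K ∩ S) = 0`, contradiction
  ---------------------------------------------------------------------------------------------
  obtain ⟨Mf, hMf0, hflux⟩ :=
    DeRosaDrivasInversiIsett2025.localizedFluxBound hd hT hsol hP32 hq hq' hσ hvB hbal hη
  have hφc : Continuous (uncurry fun (t : ℝ) (_ : UnitAddTorus d) => η t) := hηc.comp continuous_fst
  have hnull := DeRosaDrivasInversiIsett2025.measure_eq_zero_of_localizedFluxBound (T := T) D hq hq'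
    hσ hφc (fun t _ => hη01 t) (fun t ht _ => hη1 t ht) hMf0 hflux hs hcond hρ₀pos hρ₀4 haa hbb
    (A := K ∩ S) (fun z hz => hz.1) (measure_mono_null inter_subset_right hH)
  exact hDKS.ne' hnull

/-- **De Rosa–Drivas–Inversi–Isett 2025, Cor. 5.1 (with Thm. 1.1(i) and Cor. 1.2), discharged**:
the named fact `DeRosaDrivasInversiIsett2025_cor51` of `IntermittentDissipation` holds. Finite
exponents are `DeRosaDrivasInversiIsett2025_cor51_finite`; `p = ∞` is reduced to a large finite
exponent (the strict threshold `1 - (d+1-s) < 2σ/(1-σ)` persists for some finite `p' ≥ 3`,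
`DeRosaIsett2024.exists_finite_exponent`, and `‖·‖_{L^{p'}_t B^σ_{p',∞}} ≤ T^{1/p'}‖·‖_{L^∞_t B^σ_{∞,∞}}`
on the probability space `T^d`, `DeRosaIsett2024.eLpBesovSupNorm_le_top_mul`). [cite: DeRosaDrivasInversiIsett2025, Cor. 5.1, Thm. 1.1(i) and Cor. 1.2] -/
theorem DeRosaDrivasInversiIsett2025_cor51_holds : DeRosaDrivasInversiIsett2025_cor51 := by
  intro d _ _ hd T hT ν hν hν₀ u p hNS hzeroth D hD S hconc s hs hH q hq σ hσ hcond
  rintro ⟨M, hM⟩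
  rcases eq_or_ne q ⊤ with rfl | hq'
  · -- `p = ∞`: reduce to a large finite exponent
    obtain ⟨N, hN3, hcondN⟩ :=
      DeRosaIsett2024.exists_finite_exponent (n := (Fintype.card d : ℝ) + 1) (γ := s) hcond
    have hN3' : (3 : ℝ≥0∞) ≤ N := by exact_mod_cast hN3
    set C : ℝ≥0∞ := volume (Ioo 0 T) ^ (1 / (N : ℝ≥0∞).toReal) with hC
    have hCtop : C ≠ ⊤ := by
      refine ENNReal.rpow_ne_top_of_nonneg (by positivity) ?_
      rw [Real.volume_Ioo]; exact ENNReal.ofReal_ne_top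
    have hN0 : (N : ℝ≥0∞) ≠ 0 := by exact_mod_cast (show N ≠ 0 by omega)
    have hle : ∀ j, eLpBesovSupNorm N σ N (u j) volume (Ioo 0 T) ≤ (M : ℝ≥0∞) * C := fun j => by
      refine (DeRosaIsett2024.eLpBesovSupNorm_le_top_mul (u j) measurableSet_Ioo σ (fun t ht => ?_) hN0
        (ENNReal.natCast_ne_top N)).trans (by gcongr; exact hM j)
      have hmem := FunctionSpaces.Torus.IsSmooth.memBesovSup_holds
        ((hNS j).smooth_velocity.isSmooth_slice ht) hσ.2.le ⊤
      unfold FunctionSpaces.eBesovSupNorm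
      exact ENNReal.add_ne_top.2 ⟨hmem.1.eLpNorm_ne_top, hmem.2.ne⟩
    have hMC : (M : ℝ≥0∞) * C = ((M * C.toNNReal : ℝ≥0) : ℝ≥0∞) := by
      rw [ENNReal.coe_mul, ENNReal.coe_toNNReal hCtop]
    exact DeRosaDrivasInversiIsett2025_cor51_finite hd hT hν hν₀ hNS hzeroth hD hconc hs hH hN3'
      (ENNReal.natCast_ne_top N) hσ hcondN (M := M * C.toNNReal) (fun j => by rw [← hMC]; exact hle j)
  · exact DeRosaDrivasInversiIsett2025_cor51_finite hd hT hν hν₀ hNS hzeroth hD hconc hs hH hq hq' hσ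
      hcond hM

end Assembly

end Literature.Barriers.AnomalousDissipation

end
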